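import Literature.MathematicalPhysics.QuantumFieldTheory.Balaban1983to89.B3Eq326ZeroLattice
import Literature.MathematicalPhysics.QuantumFieldTheory.Balaban1983to89.B3Ineq314ZeroLattice

/-!
# `Balaban1983to89.B3Ineq326LastBracketLattice` — T. Bałaban, *(Higgs)₂,₃ quantum fields in a finite volume. III. Renormalization*,
# Commun. Math. Phys. **88** (1983) 411–445 [Balaban1983Higgs3], p. 440 [PDF 30]: the sentence after **(3.26)** on its LAST CURLY
# BRACKET — *"The expressions in the last curly bracket above are the generalized expressions of the same form as in (3.11), they
# have positive degree −d+3+α and can be analyzed as in (3.13), (3.14), and Proposition 2.2 can be applied."* — the (3.13)/(3.14)-type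
# estimates of that bracket PROVED ON THE PRINT'S CARRIER `ηℤ^{d+1}` for p39's `B3Eq326ZeroLattice.curly2Z` BY NAME (pointwise, localized,
# printed cube forms, the Taylor-remainder specialization that enters p39's `eq326Z`), and the four kernel hypotheses DISCHARGED for the
# pieces `G^η_{(j)}(0)` of `G_k(0)` — the `ηℤ^{d+1}` twin of p20 g3–g5's TORUS files of record `B3Ineq326Curly` (`abs_kerC_le`,
# `abs_curly2_le`), `B3Ineq326CurlyLocal` (`abs_curly2_le_local`), `B3Ineq326CurlyCubes` (cube forms) on r15's `curly2`

statement-level skeleton of published theorems with citation tags; proofs where landed; nothing here is a claim about the Yang–Mills mass gap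

PDF held: `paper:balaban1983-higgs-2-3-quantum-fields-finite-volume` (journal page = PDF page + 410); p. 440 [PDF 30] read first-hand on
the ×2 render `run/shared/lean/pub/pub-balaban/b2b-balaban-ref1/pages/1983-cmp88-higgs23-III/1983-cmp88-higgs23-III-p030-x2.png` (the
text layer garbles (3.26)); p. 436 [PDF 26] ((3.13)/(3.14)) via p26's transcript in `B3Ineq313Lattice`.

CITATION HEADER (lean-in-tree rule).  Part of the lit-balaban TYPED SKELETON (HOME `run/shared/lean/pub/lit-balaban/`), PHASE 2, seat p32
gen 30 (unit `lit-balaban-p32`; free-target protocol G.5-34(d); TAKING line HOME/STATUS.md 2026-08-23T01:59:30Z, owner ruling r15 g14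
02:10:35Z): member **(δ)** of the fold owner r15's head residual of SKELETON row **B3.Eq3.25-3.32** (`lit-balaban-r15/B3-CLOSURE.md` v1.21 §5
item 15) on the print's carrier.  p39 g17's `B3Eq326ZeroLattice` (p349037) TYPES (3.26) on `ηℤ^{d+1}` — `dAdjKernelZ`, `d2KernelZ`, `kerAZ`,
`kerBZ`, `kerCZ`, `pairSumZ`, `curly2Z`, `eq326Z` (Taylor (3.10) applied, remainder leg `rem η⁻¹ (g′A′_{μ′})`) — and says in its HONEST SCOPE:
*"(δ) The LAST curly bracket of (3.26) is DEFINED (`curly2Z`, remainder leg) and enters `eq326Z`, but its (3.13)/(3.14)-type bound … is NOT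
proved here"*.  THIS FILE proves it, on p39's objects BY NAME (no second vocabulary), transcribing to `ηℤ^{d+1}` the TORUS proofs of record — p20 g3
`B3Ineq326Curly.abs_kerC_le`/`abs_curly2_le`, p20 g4 `B3Ineq326CurlyLocal.abs_curly2_le_local`, p20 g5 `B3Ineq326CurlyCubes` — in the
architecture of p26's `B3Ineq313Lattice` §3/§5 (`abs_term312Z_le(_local)(_cubes)`): termwise |kernel|·|kernel|·|remainder|, p20's
`exp_mul_weight_le(_local)`, p26's `sum_sum_le_cubesZ`, FILE A's `norm_rem_le`, and — for the instance, which has no torus counterpart —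
p26's `B3Ineq211ZeroLattice.ineq210_zeroLatticeH` + FILE C's `abs_gpieceZ_le` / `abs_pieceLatMixed_le` (+ `B3Ineq210ZeroLattice.pieceLat_comm`
for the column difference); nothing of another seat is modified or restated.  (RECORD NOTE: this seat's torus file `B3Ineq326LastBracket`
(p349420) turned out to duplicate p20 g3–g5's three files — written before they were seen; it is a duplicate witness only, p20's files are the
files of record for the torus half, and nothing here imports it.)

THE PRINTED TEXT (verbatim from the render, p. 440; `d` = the print's dimension).  The last curly bracket of (3.26):
*"+ { Σ_{x,x′} η^{2d} Σ_{μ,μ′=1}^d g(x)A_μ(x) tr q²[ −(G^η_{(j)}(0)∂^{η*}_{μ′})(x,x′)(G^η_{(j′)}(0)∂^{η*}_μ)(x′,x)|x′−x|^{1+α}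
+ G^η_{(j)}(0;x,x′)(∂^η_{μ′}G^η_{(j′)}(0)∂^{η*}_μ)(x′,x)|x′−x|^{1+α} ] · Σ_{b⊂Γ_{x,x′}} (η|b_−−x|^α/|x′−x|^{1+α})
((∂^ηg′A′_{μ′})(b) − (∂^ηg′A′_{μ′})((b)_x))/|b_−−x|^α },  (3.26)  where A, A′ are external vector field legs. The expressions in the last
curly bracket above are the generalized expressions of the same form as in (3.11), they have positive degree −d+3+α and can be analyzed as
in (3.13), (3.14), and Proposition 2.2 can be applied."*  ((3.13)/(3.14), p. 436, verbatim in `B3Ineq313Lattice`'s module docstring.)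

WHAT IS REPRODUCED, and how (kind «one-scale analytic inequality, ≤ 1 printed page», G.2(c); every theorem proved; NO definition).
* §1 `abs_kerCZ_le` (p39's combined kernel `kerCZ = −kerAZ + kerBZ` under (2.10)-type bounds on `G_{(j)}∂*`, `G_{(j′)}∂*`, `G_{(j)}`,
  `∂G_{(j′)}∂*`: `|kerCZ| ≤ |τ|(C₁C₂s^{1−(d+1)}s′^{1−(d+1)} + C₃C₄s^{2−(d+1)}s′^{−(d+1)})e^{−δu/s}e^{−δu/s′}`, `u = η|x−x′|₁`);
  **`abs_curly2Z_le`** = the (3.13)-type bound: with `|g| ≤ 1` and the remainder bound `|R_{μ′}(x,x′)| ≤ H·u·u^α` (`0 ≤ α ≤ 1`),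
  `|curly2Z| ≤ (d+1)|τ|(…)H(2/δ+8/δ²)(m·m^α)Σ_{x∈Λ,x′∈Λ′}η^{2(d+1)}(Σ_μ|A_μ(x)|)e^{−½δu/s}e^{−½δu/s′}`, `m = min(s,s′) = L^{j₁}η` (the printed
  mechanism: the weight `|x′−x|^{1+α}` costs `(L^{j₁}η)^{1+α}` and *"half of the exponential factor with index j₁"*);
  **`abs_curly2Z_le_local`** = the (3.14)-type bound (remainder bound localized around the second leg `x″` of the propagator carrying `A′` —
  the shape of FILE A's `norm_rem_le_of_leg` —, `max(s,s′) ≤ s″`: the extra displayed factor `e^{−½δη|x−x″|₁/s″}`).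
* §2 **`abs_curly2Z_le_cubes`** / **`abs_curly2Z_le_local_cubes`** = the printed cube-localized forms `Σ_{Δ(v),Δ(v′)}(Mη)^{2(d+1)} sup …`
  (p26's `sum_sum_le_cubesZ`, every cube side `M ≥ 1`; print `M = L^{j₁}`); **`abs_curly2Z_rem_le`** = the bound for the remainder leg
  `R μ′ = B3Taylor310Lattice.rem η⁻¹ (g′A′_{μ′})` THAT ENTERS p39's `eq326Z`, under the Hölder hypothesis on `∂^η(g′A′_{μ′})` (*"a
  differentiation of the order 1 + α"*, FILE A's `norm_rem_le`) — the printed bracket LITERALLY.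
* §3 THE KERNEL HYPOTHESES DISCHARGED for the pieces `G^η_{(j)}(0) = gpieceZ j` of `G_k(0)` on `ηℤ^{d+1}`: `abs_dAdjKernelZ_gpieceZ_le`
  (ONE COLUMN DIFFERENCE `G^η_{(j)}(0)∂*_μ` from the carrier's (2.10) derivative member + the symmetry `pieceLat_comm`),
  `abs_d2KernelZ_gpieceZ_le` (`∂_{μ′}G^η_{(j)}(0)∂*_μ` for ARBITRARY axes, from FILE C's located `abs_pieceLatMixed_le`; the off-diagonal twin
  of FILE C's `abs_dKernelZ_gpieceZ_le`) ⇒ **`abs_curly2Z_le_zeroLattice`**: the (3.13)-type bound for `curly2Z η (gpieceZ j) (gpieceZ j′)`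
  with NO kernel hypothesis, constants `δ′, C′` from `L` and the window only, uniform in `k, j, j′`; **`abs_curly2Z_rem_le_zeroLattice`**
  = the same for the remainder leg `rem η⁻¹ (g′A′_{μ′})` that enters p39's `eq326Z` (only the Hölder hypothesis on `∂^η(g′A′_{μ′})` left);
  the dictionary FILE C `etaZ` ↔ p39's `xiOf` is p39's `B3Eq317ZeroLattice.etaZ_eq_xiOf` (landed; not restated here).

HONEST SCOPE / DECLARED DIVERGENCES (F7).  (i) As p26's FILE B / p39's F3: zero background, `|x − x′|` = `η·dist₁` (`ℓ¹`), `|g| ≤ 1` a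
hypothesis, `tr q²` an arbitrary real `τ`, the vector legs real-valued per component (`A μ x`, p39's convention).  (ii) The remainder `R`
is DATA with a bound hypothesis in §1/§2 (as r15's `eq326`/p39's `curly2Z` take it; the printed `|x′−x|^{1+α}` inserted and divided is not
performed); `abs_curly2Z_rem_le` takes p39's remainder leg under a GLOBAL Hölder hypothesis on `∂^η(g′A′_{μ′})` — the product-rule step
splitting it into one on `g′` (p. 420 smooth localizations) and one on `A′` is NOT performed.  (iii) §3 discharges the two-propagator
KERNEL hypotheses only (pieces `gpieceZ` of FILE C's currency; p39's resummed `GetaL` is the sum of pieces — resummation is not performed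
here, the print analyses the last bracket piece by piece); the leg/remainder hypothesis stays, as in FILE C's `abs_term312Z_le_zeroLattice`.
(iv) Constants explicit; dimension `d + 1 ≥ 1` arbitrary; cube sides arbitrary `M ≥ 1`.  (v) The degree count «positive degree −d+3+α»
and «Proposition 2.2 can be applied» are NOT formalized here (rows B3.Eq2.13-2.14 / B3.Prop2.2); this file is the analytic (3.13)/(3.14)
step only.  Theorems only; no Literature fact minted, no `sorry`; standard axioms.  Value = one located member of row B3.Eq3.25-3.32, NOT
summit progress.
Unit `lit-balaban-p32` (Phase-2 proof seat p32, gen 30); HOME `run/shared/lean/pub/lit-balaban/` (row B3.Eq3.25-3.32, FILED.md, STATUS.md),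
2026-08-23.
-/

open scoped BigOperators

namespace Literature.MathematicalPhysics.QuantumFieldTheory.Balaban1983to89.B3Ineq326LastBracketLattice

open B3Eq326ZeroLattice (dAdjKernelZ d2KernelZ kerAZ kerBZ kerCZ pairSumZ curly2Z)
open B3Ineq313Pointwise (exp_mul_weight_le)
open B3Ineq314Local (exp_mul_weight_le_local)
open B3Ineq314Cubes (supOn le_supOn supOn_le supOn_nonneg)

noncomputable section

/-! ## §0 Elementary kernel lemmas -/

section Elementary

/-- kernel: a constant dominating an absolute value through two positive factors is nonnegative. [folklore] -/
private theorem nonneg_of_abs_le_mul_mul {v C p e : ℝ} (h : |v| ≤ C * p * e) (hp : 0 < p) (he : 0 < e) : 0 ≤ C :=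
  nonneg_of_mul_nonneg_left (nonneg_of_mul_nonneg_left ((abs_nonneg v).trans h) he) hp

/-- kernel: a double sum over the axes of terms bounded by `a μ · B` (`B` independent of the axes) is at most `(Σ_μ a μ)·(n·B)`.
[folklore] -/
private theorem abs_sum_sum_le_sum_mul {n : ℕ} (t : Fin n → Fin n → ℝ) (a : Fin n → ℝ) (B : ℝ)
    (h : ∀ μ μ', |t μ μ'| ≤ a μ * B) :
    |∑ μ : Fin n, ∑ μ' : Fin n, t μ μ'| ≤ (∑ μ : Fin n, a μ) * ((n : ℝ) * B) := by
  calc |∑ μ : Fin n, ∑ μ' : Fin n, t μ μ'| ≤ ∑ μ : Fin n, |∑ μ' : Fin n, t μ μ'| := Finset.abs_sum_le_sum_abs _ _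
    _ ≤ ∑ μ : Fin n, ∑ μ' : Fin n, |t μ μ'| := Finset.sum_le_sum fun μ _ => Finset.abs_sum_le_sum_abs _ _
    _ ≤ ∑ μ : Fin n, ∑ _μ' : Fin n, a μ * B := Finset.sum_le_sum fun μ _ => Finset.sum_le_sum fun μ' _ => h μ μ'
    _ = (∑ μ : Fin n, a μ) * ((n : ℝ) * B) := by
        simp only [Finset.sum_const, Finset.card_univ, Fintype.card_fin, nsmul_eq_mul, Finset.sum_mul]
        exact Finset.sum_congr rfl fun μ _ => by ring

end Elementary

/-! ## §1 The (3.13)/(3.14)-type bounds for p39's `curly2Z` on `ηℤ^{d+1}` -/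

section LatticeBounds

variable {d : ℕ}

open B3Taylor310Lattice (dist₁ dist₁_comm pd rem HolderDeriv norm_rem_le norm_rem_le_of_leg)
open B3Ineq313Lattice (KernelZ cubeIdxZ cubesZ fiberZ cdistZ sum_sum_le_cubesZ exp_dist₁_le_exp_cdistZ)

/-- **The combined kernel of (3.26) under (2.10)-type kernel bounds on `ηℤ^{d+1}`** (twin of p20's torus `B3Ineq326Curly.abs_kerC_le`):
`|kerCZ_{μμ′}(x,x′)| ≤ |τ|(C₁s^{1−(d+1)}·C₂s′^{1−(d+1)} + C₃s^{2−(d+1)}·C₄s′^{−(d+1)})e^{−δu/s}e^{−δu/s′}`, `u = η|x − x′|₁`.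
[cite: Balaban1983Higgs3, (3.26) p.440] -/
theorem abs_kerCZ_le {η τ C₁ C₂ C₃ C₄ δ s s' : ℝ} {Gj Gj' : KernelZ d}
    (hA : ∀ (μ' : Fin (d + 1)) (y y' : Fin (d + 1) → ℤ),
      |dAdjKernelZ η⁻¹ μ' Gj y y'| ≤ C₁ * s ^ (1 - ((d + 1 : ℕ) : ℝ)) * Real.exp (-(δ * s⁻¹ * (η * dist₁ y y'))))
    (hA' : ∀ (μ : Fin (d + 1)) (y y' : Fin (d + 1) → ℤ),
      |dAdjKernelZ η⁻¹ μ Gj' y y'| ≤ C₂ * s' ^ (1 - ((d + 1 : ℕ) : ℝ)) * Real.exp (-(δ * s'⁻¹ * (η * dist₁ y y'))))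
    (hB : ∀ y y' : Fin (d + 1) → ℤ, |Gj y y'| ≤ C₃ * s ^ (2 - ((d + 1 : ℕ) : ℝ)) * Real.exp (-(δ * s⁻¹ * (η * dist₁ y y'))))
    (hB' : ∀ (μ' μ : Fin (d + 1)) (y y' : Fin (d + 1) → ℤ),
      |d2KernelZ η⁻¹ μ' μ Gj' y y'| ≤ C₄ * s' ^ (-((d + 1 : ℕ) : ℝ)) * Real.exp (-(δ * s'⁻¹ * (η * dist₁ y y'))))
    (μ μ' : Fin (d + 1)) (x x' : Fin (d + 1) → ℤ) :
    |kerCZ η τ Gj Gj' μ μ' x x'| ≤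
      |τ| * (C₁ * s ^ (1 - ((d + 1 : ℕ) : ℝ)) * (C₂ * s' ^ (1 - ((d + 1 : ℕ) : ℝ))) +
          C₃ * s ^ (2 - ((d + 1 : ℕ) : ℝ)) * (C₄ * s' ^ (-((d + 1 : ℕ) : ℝ)))) *
        (Real.exp (-(δ * s⁻¹ * (η * dist₁ x x'))) * Real.exp (-(δ * s'⁻¹ * (η * dist₁ x x')))) := by
  set u : ℝ := η * dist₁ x x' with hu
  have hux : η * (dist₁ x' x : ℝ) = u := by rw [dist₁_comm x' x]
  have h1 := hA μ' x x'
  have h2 := hA' μ x' x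
  have h3 := hB x x'
  have h4 := hB' μ' μ x' x
  rw [hux] at h2 h4
  have e1 : 0 ≤ C₁ * s ^ (1 - ((d + 1 : ℕ) : ℝ)) * Real.exp (-(δ * s⁻¹ * u)) := (abs_nonneg _).trans h1
  have e3 : 0 ≤ C₃ * s ^ (2 - ((d + 1 : ℕ) : ℝ)) * Real.exp (-(δ * s⁻¹ * u)) := (abs_nonneg _).trans h3
  have hAk : |kerAZ η τ Gj Gj' μ μ' x x'| ≤ |τ| * ((C₁ * s ^ (1 - ((d + 1 : ℕ) : ℝ)) * Real.exp (-(δ * s⁻¹ * u))) *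
      (C₂ * s' ^ (1 - ((d + 1 : ℕ) : ℝ)) * Real.exp (-(δ * s'⁻¹ * u)))) := by
    unfold kerAZ
    rw [abs_mul, abs_mul]
    exact mul_le_mul_of_nonneg_left (mul_le_mul h1 h2 (abs_nonneg _) e1) (abs_nonneg _)
  have hBk : |kerBZ η τ Gj Gj' μ μ' x x'| ≤ |τ| * ((C₃ * s ^ (2 - ((d + 1 : ℕ) : ℝ)) * Real.exp (-(δ * s⁻¹ * u))) *
      (C₄ * s' ^ (-((d + 1 : ℕ) : ℝ)) * Real.exp (-(δ * s'⁻¹ * u)))) := by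
    unfold kerBZ
    rw [abs_mul, abs_mul]
    exact mul_le_mul_of_nonneg_left (mul_le_mul h3 h4 (abs_nonneg _) e3) (abs_nonneg _)
  unfold kerCZ
  calc |-kerAZ η τ Gj Gj' μ μ' x x' + kerBZ η τ Gj Gj' μ μ' x x'|
      ≤ |-kerAZ η τ Gj Gj' μ μ' x x'| + |kerBZ η τ Gj Gj' μ μ' x x'| := abs_add_le _ _
    _ = |kerAZ η τ Gj Gj' μ μ' x x'| + |kerBZ η τ Gj Gj' μ μ' x x'| := by rw [abs_neg]
    _ ≤ |τ| * ((C₁ * s ^ (1 - ((d + 1 : ℕ) : ℝ)) * Real.exp (-(δ * s⁻¹ * u))) *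
          (C₂ * s' ^ (1 - ((d + 1 : ℕ) : ℝ)) * Real.exp (-(δ * s'⁻¹ * u))))
        + |τ| * ((C₃ * s ^ (2 - ((d + 1 : ℕ) : ℝ)) * Real.exp (-(δ * s⁻¹ * u))) *
          (C₄ * s' ^ (-((d + 1 : ℕ) : ℝ)) * Real.exp (-(δ * s'⁻¹ * u)))) := add_le_add hAk hBk
    _ = _ := by ring

/-- kernel: the per-pair bound behind `abs_curly2Z_le` (the axis double sum against `Σ_μ|A_μ(x)|`). [cite: Balaban1983Higgs3, (3.26) p.440] -/
private theorem abs_pairTermZ_le {η τ K : ℝ} {Gj Gj' : KernelZ d} {g : (Fin (d + 1) → ℤ) → ℝ} (hg : ∀ x, |g x| ≤ 1)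
    {A : Fin (d + 1) → (Fin (d + 1) → ℤ) → ℝ} {R : Fin (d + 1) → (Fin (d + 1) → ℤ) → (Fin (d + 1) → ℤ) → ℝ}
    {E ρ : (Fin (d + 1) → ℤ) → (Fin (d + 1) → ℤ) → ℝ}
    (hK : ∀ (μ μ' : Fin (d + 1)) (x x' : Fin (d + 1) → ℤ), |kerCZ η τ Gj Gj' μ μ' x x'| ≤ K * E x x') (hK0 : 0 ≤ K)
    (hE : ∀ x x', 0 ≤ E x x') (hR : ∀ (μ' : Fin (d + 1)) (x x' : Fin (d + 1) → ℤ), |R μ' x x'| ≤ ρ x x') (hη : 0 ≤ η)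
    (x x' : Fin (d + 1) → ℤ) :
    |η ^ (2 * (d + 1)) * ∑ μ : Fin (d + 1), ∑ μ' : Fin (d + 1), g x * A μ x * kerCZ η τ Gj Gj' μ μ' x x' * R μ' x x'| ≤
      η ^ (2 * (d + 1)) * ((∑ μ : Fin (d + 1), |A μ x|) * (((d + 1 : ℕ) : ℝ) * (K * E x x' * ρ x x'))) := by
  rw [abs_mul, abs_of_nonneg (pow_nonneg hη _)]
  refine mul_le_mul_of_nonneg_left ?_ (pow_nonneg hη _)
  refine abs_sum_sum_le_sum_mul _ (fun μ => |A μ x|) (K * E x x' * ρ x x') fun μ μ' => ?_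
  rw [abs_mul, abs_mul, abs_mul]
  have h1 : |g x| * |A μ x| ≤ 1 * |A μ x| := mul_le_mul_of_nonneg_right (hg x) (abs_nonneg _)
  have h2 : |g x| * |A μ x| * |kerCZ η τ Gj Gj' μ μ' x x'| ≤ 1 * |A μ x| * (K * E x x') :=
    mul_le_mul h1 (hK μ μ' x x') (abs_nonneg _) (mul_nonneg zero_le_one (abs_nonneg _))
  calc |g x| * |A μ x| * |kerCZ η τ Gj Gj' μ μ' x x'| * |R μ' x x'|
      ≤ 1 * |A μ x| * (K * E x x') * ρ x x' :=
        mul_le_mul h2 (hR μ' x x') (abs_nonneg _)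
          (mul_nonneg (mul_nonneg zero_le_one (abs_nonneg _)) (mul_nonneg hK0 (hE x x')))
    _ = |A μ x| * (K * E x x' * ρ x x') := by ring

/-- kernel: the summation step on `ℤ^{d+1}` — a termwise bound over `Λ × Λ′` sums. [folklore] -/
private theorem abs_sum_sum_le_of_termwiseZ {Λ Λ' : Finset (Fin (d + 1) → ℤ)} {t b : KernelZ d} {K : ℝ}
    (h : ∀ x x', |t x x'| ≤ K * b x x') :
    |∑ x ∈ Λ, ∑ x' ∈ Λ', t x x'| ≤ K * ∑ x ∈ Λ, ∑ x' ∈ Λ', b x x' := by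
  calc |∑ x ∈ Λ, ∑ x' ∈ Λ', t x x'| ≤ ∑ x ∈ Λ, |∑ x' ∈ Λ', t x x'| := Finset.abs_sum_le_sum_abs _ _
    _ ≤ ∑ x ∈ Λ, ∑ x' ∈ Λ', |t x x'| := Finset.sum_le_sum fun x _ => Finset.abs_sum_le_sum_abs _ _
    _ ≤ ∑ x ∈ Λ, ∑ x' ∈ Λ', K * b x x' := Finset.sum_le_sum fun x _ => Finset.sum_le_sum fun x' _ => h x x'
    _ = K * ∑ x ∈ Λ, ∑ x' ∈ Λ', b x x' := by
        rw [Finset.mul_sum]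
        exact Finset.sum_congr rfl fun x _ => by rw [Finset.mul_sum]

/-- **The last curly bracket of (3.26), the (3.13)-type bound on `ηℤ^{d+1}`** (twin of p20's torus `B3Ineq326Curly.abs_curly2_le`; p. 440
*"analyzed as in (3.13)"*),
PROVED: under the (2.10)-type bounds on the four kernels at the scales `s = L^jη`, `s′ = L^{j′}η`, `|g| ≤ 1`, and the remainder bound
`|R_{μ′}(x,x′)| ≤ H·u·u^α` (`u = η|x−x′|₁`, `0 ≤ α ≤ 1`), for every pair of finite localization sets
`|curly2Z| ≤ (d+1)|τ|(C₁C₂s^{1−(d+1)}s′^{1−(d+1)} + C₃C₄s^{2−(d+1)}s′^{−(d+1)})H(2/δ+8/δ²)(m·m^α)Σ_{x∈Λ,x′∈Λ′}η^{2(d+1)}(Σ_μ|A_μ(x)|)e^{−½δu/s}e^{−½δu/s′}`,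
`m = min(s,s′)`. [cite: Balaban1983Higgs3, (3.26) p.440] -/
theorem abs_curly2Z_le (η : ℝ) (hη : 0 < η) {α H τ C₁ C₂ C₃ C₄ δ s s' : ℝ} (hα0 : 0 ≤ α) (hα1 : α ≤ 1) (hH : 0 ≤ H)
    (hδ : 0 < δ) (hs : 0 < s) (hs' : 0 < s') (Gj Gj' : KernelZ d) (g : (Fin (d + 1) → ℤ) → ℝ) (hg : ∀ x, |g x| ≤ 1)
    (A : Fin (d + 1) → (Fin (d + 1) → ℤ) → ℝ)
    (hA : ∀ (μ' : Fin (d + 1)) (y y' : Fin (d + 1) → ℤ),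
      |dAdjKernelZ η⁻¹ μ' Gj y y'| ≤ C₁ * s ^ (1 - ((d + 1 : ℕ) : ℝ)) * Real.exp (-(δ * s⁻¹ * (η * dist₁ y y'))))
    (hA' : ∀ (μ : Fin (d + 1)) (y y' : Fin (d + 1) → ℤ),
      |dAdjKernelZ η⁻¹ μ Gj' y y'| ≤ C₂ * s' ^ (1 - ((d + 1 : ℕ) : ℝ)) * Real.exp (-(δ * s'⁻¹ * (η * dist₁ y y'))))
    (hB : ∀ y y' : Fin (d + 1) → ℤ, |Gj y y'| ≤ C₃ * s ^ (2 - ((d + 1 : ℕ) : ℝ)) * Real.exp (-(δ * s⁻¹ * (η * dist₁ y y'))))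
    (hB' : ∀ (μ' μ : Fin (d + 1)) (y y' : Fin (d + 1) → ℤ),
      |d2KernelZ η⁻¹ μ' μ Gj' y y'| ≤ C₄ * s' ^ (-((d + 1 : ℕ) : ℝ)) * Real.exp (-(δ * s'⁻¹ * (η * dist₁ y y'))))
    (R : Fin (d + 1) → (Fin (d + 1) → ℤ) → (Fin (d + 1) → ℤ) → ℝ)
    (hR : ∀ (μ' : Fin (d + 1)) (x x' : Fin (d + 1) → ℤ), |R μ' x x'| ≤ H * (η * dist₁ x x') * (η * dist₁ x x') ^ α)
    (Λ Λ' : Finset (Fin (d + 1) → ℤ)) :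
    |curly2Z η τ Gj Gj' g A R Λ Λ'| ≤
      ((d + 1 : ℕ) : ℝ) * |τ| * (C₁ * C₂ * (s ^ (1 - ((d + 1 : ℕ) : ℝ)) * s' ^ (1 - ((d + 1 : ℕ) : ℝ))) +
          C₃ * C₄ * (s ^ (2 - ((d + 1 : ℕ) : ℝ)) * s' ^ (-((d + 1 : ℕ) : ℝ))))
        * H * (2 / δ + 8 / δ ^ 2) * (min s s' * (min s s') ^ α) *
        ∑ x ∈ Λ, ∑ x' ∈ Λ', η ^ (2 * (d + 1)) *
          ((∑ μ : Fin (d + 1), |A μ x|) *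
            (Real.exp (-(δ / 2 * s⁻¹ * (η * dist₁ x x'))) * Real.exp (-(δ / 2 * s'⁻¹ * (η * dist₁ x x'))))) := by
  have hC₁ : 0 ≤ C₁ := nonneg_of_abs_le_mul_mul (hA 0 0 0) (Real.rpow_pos_of_pos hs _) (Real.exp_pos _)
  have hC₂ : 0 ≤ C₂ := nonneg_of_abs_le_mul_mul (hA' 0 0 0) (Real.rpow_pos_of_pos hs' _) (Real.exp_pos _)
  have hC₃ : 0 ≤ C₃ := nonneg_of_abs_le_mul_mul (hB 0 0) (Real.rpow_pos_of_pos hs _) (Real.exp_pos _)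
  have hC₄ : 0 ≤ C₄ := nonneg_of_abs_le_mul_mul (hB' 0 0 0 0) (Real.rpow_pos_of_pos hs' _) (Real.exp_pos _)
  set Ksc : ℝ := C₁ * C₂ * (s ^ (1 - ((d + 1 : ℕ) : ℝ)) * s' ^ (1 - ((d + 1 : ℕ) : ℝ))) +
    C₃ * C₄ * (s ^ (2 - ((d + 1 : ℕ) : ℝ)) * s' ^ (-((d + 1 : ℕ) : ℝ))) with hKsc
  have hKsc0 : 0 ≤ Ksc := by positivity
  have hpair := fun x x' => abs_pairTermZ_le (η := η) (τ := τ) (Gj := Gj) (Gj' := Gj') hg (A := A) (R := R)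
    (E := fun x x' => Real.exp (-(δ * s⁻¹ * (η * dist₁ x x'))) * Real.exp (-(δ * s'⁻¹ * (η * dist₁ x x'))))
    (ρ := fun x x' => H * (η * dist₁ x x') * (η * dist₁ x x') ^ α) (K := |τ| * Ksc)
    (fun μ μ' x x' => by
      have h := abs_kerCZ_le (τ := τ) hA hA' hB hB' μ μ' x x'
      rw [hKsc]
      refine h.trans (le_of_eq ?_)
      ring)
    (mul_nonneg (abs_nonneg _) hKsc0) (fun x x' => by positivity) hR hη.le x x'
  unfold curly2Z pairSumZ
  refine (abs_sum_sum_le_of_termwiseZ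
    (K := ((d + 1 : ℕ) : ℝ) * |τ| * Ksc * H * (2 / δ + 8 / δ ^ 2) * (min s s' * (min s s') ^ α))
    fun x x' => ?_).trans (le_of_eq (by rw [hKsc]))
  refine (hpair x x').trans ?_
  set u : ℝ := η * dist₁ x x' with hu
  have hu0 : 0 ≤ u := mul_nonneg hη.le (Nat.cast_nonneg _)
  have hw := exp_mul_weight_le hδ hs hs' hu0 hα0 hα1
  have hX : 0 ≤ η ^ (2 * (d + 1)) * ((∑ μ : Fin (d + 1), |A μ x|) * (((d + 1 : ℕ) : ℝ) * (|τ| * Ksc) * H)) := by positivity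
  calc η ^ (2 * (d + 1)) * ((∑ μ : Fin (d + 1), |A μ x|) * (((d + 1 : ℕ) : ℝ) * (|τ| * Ksc *
        (Real.exp (-(δ * s⁻¹ * u)) * Real.exp (-(δ * s'⁻¹ * u))) * (H * u * u ^ α))))
      = η ^ (2 * (d + 1)) * ((∑ μ : Fin (d + 1), |A μ x|) * (((d + 1 : ℕ) : ℝ) * (|τ| * Ksc) * H)) *
          (Real.exp (-(δ * s⁻¹ * u)) * Real.exp (-(δ * s'⁻¹ * u)) * (u * u ^ α)) := by ring
    _ ≤ η ^ (2 * (d + 1)) * ((∑ μ : Fin (d + 1), |A μ x|) * (((d + 1 : ℕ) : ℝ) * (|τ| * Ksc) * H)) *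
          ((2 / δ + 8 / δ ^ 2) * (min s s' * (min s s') ^ α) *
            (Real.exp (-(δ / 2 * s⁻¹ * u)) * Real.exp (-(δ / 2 * s'⁻¹ * u)))) := mul_le_mul_of_nonneg_left hw hX
    _ = ((d + 1 : ℕ) : ℝ) * |τ| * Ksc * H * (2 / δ + 8 / δ ^ 2) * (min s s' * (min s s') ^ α) *
          (η ^ (2 * (d + 1)) * ((∑ μ : Fin (d + 1), |A μ x|) *
            (Real.exp (-(δ / 2 * s⁻¹ * u)) * Real.exp (-(δ / 2 * s'⁻¹ * u))))) := by ring

/-- **The last curly bracket of (3.26), the (3.14)-type bound on `ηℤ^{d+1}`** (twin of p20's torus `B3Ineq326CurlyLocal.abs_curly2_le_local`):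
as `abs_curly2Z_le` with
the LOCALIZED remainder bound `|R_{μ′}(x,x′)| ≤ C₅·(u·u^α)·e^{+½δu/s″}·e^{−½δη|x−x″|₁/s″}` around the second leg `x″` of the propagator
carrying `A′` (the shape delivered by FILE A's `B3Taylor310Lattice.norm_rem_le_of_leg`), `max(s,s′) ≤ s″`: the extra factor
`e^{−½δη|x−x″|₁/s″}` of (3.14). [cite: Balaban1983Higgs3, (3.26) p.440] -/
theorem abs_curly2Z_le_local (η : ℝ) (hη : 0 < η) {α τ C₁ C₂ C₃ C₄ C₅ δ s s' s'' : ℝ} (hα0 : 0 ≤ α) (hα1 : α ≤ 1)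
    (hC₅ : 0 ≤ C₅) (hδ : 0 < δ) (hs : 0 < s) (hs' : 0 < s') (hss : max s s' ≤ s'') (Gj Gj' : KernelZ d)
    (g : (Fin (d + 1) → ℤ) → ℝ) (hg : ∀ x, |g x| ≤ 1) (A : Fin (d + 1) → (Fin (d + 1) → ℤ) → ℝ)
    (hA : ∀ (μ' : Fin (d + 1)) (y y' : Fin (d + 1) → ℤ),
      |dAdjKernelZ η⁻¹ μ' Gj y y'| ≤ C₁ * s ^ (1 - ((d + 1 : ℕ) : ℝ)) * Real.exp (-(δ * s⁻¹ * (η * dist₁ y y'))))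
    (hA' : ∀ (μ : Fin (d + 1)) (y y' : Fin (d + 1) → ℤ),
      |dAdjKernelZ η⁻¹ μ Gj' y y'| ≤ C₂ * s' ^ (1 - ((d + 1 : ℕ) : ℝ)) * Real.exp (-(δ * s'⁻¹ * (η * dist₁ y y'))))
    (hB : ∀ y y' : Fin (d + 1) → ℤ, |Gj y y'| ≤ C₃ * s ^ (2 - ((d + 1 : ℕ) : ℝ)) * Real.exp (-(δ * s⁻¹ * (η * dist₁ y y'))))
    (hB' : ∀ (μ' μ : Fin (d + 1)) (y y' : Fin (d + 1) → ℤ),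
      |d2KernelZ η⁻¹ μ' μ Gj' y y'| ≤ C₄ * s' ^ (-((d + 1 : ℕ) : ℝ)) * Real.exp (-(δ * s'⁻¹ * (η * dist₁ y y'))))
    (R : Fin (d + 1) → (Fin (d + 1) → ℤ) → (Fin (d + 1) → ℤ) → ℝ) (x'' : Fin (d + 1) → ℤ)
    (hR : ∀ (μ' : Fin (d + 1)) (x x' : Fin (d + 1) → ℤ), |R μ' x x'| ≤
      C₅ * ((η * dist₁ x x') * (η * dist₁ x x') ^ α) * Real.exp (δ / 2 * s''⁻¹ * (η * dist₁ x x')) *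
        Real.exp (-(δ / 2 * s''⁻¹ * (η * dist₁ x x''))))
    (Λ Λ' : Finset (Fin (d + 1) → ℤ)) :
    |curly2Z η τ Gj Gj' g A R Λ Λ'| ≤
      ((d + 1 : ℕ) : ℝ) * |τ| * (C₁ * C₂ * (s ^ (1 - ((d + 1 : ℕ) : ℝ)) * s' ^ (1 - ((d + 1 : ℕ) : ℝ))) +
          C₃ * C₄ * (s ^ (2 - ((d + 1 : ℕ) : ℝ)) * s' ^ (-((d + 1 : ℕ) : ℝ))))
        * C₅ * (2 / δ + 8 / δ ^ 2) * (min s s' * (min s s') ^ α) *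
        ∑ x ∈ Λ, ∑ x' ∈ Λ', η ^ (2 * (d + 1)) *
          ((∑ μ : Fin (d + 1), |A μ x|) *
            (Real.exp (-(δ / 2 * s⁻¹ * (η * dist₁ x x'))) * Real.exp (-(δ / 2 * s'⁻¹ * (η * dist₁ x x'))) *
              Real.exp (-(δ / 2 * s''⁻¹ * (η * dist₁ x x''))))) := by
  have hC₁ : 0 ≤ C₁ := nonneg_of_abs_le_mul_mul (hA 0 0 0) (Real.rpow_pos_of_pos hs _) (Real.exp_pos _)
  have hC₂ : 0 ≤ C₂ := nonneg_of_abs_le_mul_mul (hA' 0 0 0) (Real.rpow_pos_of_pos hs' _) (Real.exp_pos _)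
  have hC₃ : 0 ≤ C₃ := nonneg_of_abs_le_mul_mul (hB 0 0) (Real.rpow_pos_of_pos hs _) (Real.exp_pos _)
  have hC₄ : 0 ≤ C₄ := nonneg_of_abs_le_mul_mul (hB' 0 0 0 0) (Real.rpow_pos_of_pos hs' _) (Real.exp_pos _)
  set Ksc : ℝ := C₁ * C₂ * (s ^ (1 - ((d + 1 : ℕ) : ℝ)) * s' ^ (1 - ((d + 1 : ℕ) : ℝ))) +
    C₃ * C₄ * (s ^ (2 - ((d + 1 : ℕ) : ℝ)) * s' ^ (-((d + 1 : ℕ) : ℝ))) with hKsc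
  have hKsc0 : 0 ≤ Ksc := by positivity
  have hpair := fun x x' => abs_pairTermZ_le (η := η) (τ := τ) (Gj := Gj) (Gj' := Gj') hg (A := A) (R := R)
    (E := fun x x' => Real.exp (-(δ * s⁻¹ * (η * dist₁ x x'))) * Real.exp (-(δ * s'⁻¹ * (η * dist₁ x x'))))
    (ρ := fun x x' => C₅ * ((η * dist₁ x x') * (η * dist₁ x x') ^ α) * Real.exp (δ / 2 * s''⁻¹ * (η * dist₁ x x')) *
      Real.exp (-(δ / 2 * s''⁻¹ * (η * dist₁ x x''))))
    (K := |τ| * Ksc)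
    (fun μ μ' x x' => by
      have h := abs_kerCZ_le (τ := τ) hA hA' hB hB' μ μ' x x'
      rw [hKsc]
      refine h.trans (le_of_eq ?_)
      ring)
    (mul_nonneg (abs_nonneg _) hKsc0) (fun x x' => by positivity) hR hη.le x x'
  unfold curly2Z pairSumZ
  refine (abs_sum_sum_le_of_termwiseZ
    (K := ((d + 1 : ℕ) : ℝ) * |τ| * Ksc * C₅ * (2 / δ + 8 / δ ^ 2) * (min s s' * (min s s') ^ α))
    fun x x' => ?_).trans (le_of_eq (by rw [hKsc]))
  refine (hpair x x').trans ?_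
  set u : ℝ := η * dist₁ x x' with hu
  set Ex : ℝ := Real.exp (-(δ / 2 * s''⁻¹ * (η * dist₁ x x''))) with hEx
  have hu0 : 0 ≤ u := mul_nonneg hη.le (Nat.cast_nonneg _)
  have hw := exp_mul_weight_le_local hδ hs hs' hss hu0 hα0 hα1
  have hX : 0 ≤ η ^ (2 * (d + 1)) * ((∑ μ : Fin (d + 1), |A μ x|) * (((d + 1 : ℕ) : ℝ) * (|τ| * Ksc) * C₅ * Ex)) := by
    positivity
  calc η ^ (2 * (d + 1)) * ((∑ μ : Fin (d + 1), |A μ x|) * (((d + 1 : ℕ) : ℝ) * (|τ| * Ksc *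
        (Real.exp (-(δ * s⁻¹ * u)) * Real.exp (-(δ * s'⁻¹ * u))) *
          (C₅ * (u * u ^ α) * Real.exp (δ / 2 * s''⁻¹ * u) * Ex))))
      = η ^ (2 * (d + 1)) * ((∑ μ : Fin (d + 1), |A μ x|) * (((d + 1 : ℕ) : ℝ) * (|τ| * Ksc) * C₅ * Ex)) *
          (Real.exp (-(δ * s⁻¹ * u)) * Real.exp (-(δ * s'⁻¹ * u)) * Real.exp (δ / 2 * s''⁻¹ * u) * (u * u ^ α)) := by ring
    _ ≤ η ^ (2 * (d + 1)) * ((∑ μ : Fin (d + 1), |A μ x|) * (((d + 1 : ℕ) : ℝ) * (|τ| * Ksc) * C₅ * Ex)) *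
          ((2 / δ + 8 / δ ^ 2) * (min s s' * (min s s') ^ α) *
            (Real.exp (-(δ / 2 * s⁻¹ * u)) * Real.exp (-(δ / 2 * s'⁻¹ * u)))) := mul_le_mul_of_nonneg_left hw hX
    _ = ((d + 1 : ℕ) : ℝ) * |τ| * Ksc * C₅ * (2 / δ + 8 / δ ^ 2) * (min s s' * (min s s') ^ α) *
          (η ^ (2 * (d + 1)) * ((∑ μ : Fin (d + 1), |A μ x|) *
            (Real.exp (-(δ / 2 * s⁻¹ * u)) * Real.exp (-(δ / 2 * s'⁻¹ * u)) * Ex))) := by ring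

end LatticeBounds

/-! ## §2 The printed cube-localized forms and the Taylor-remainder specialization on `ηℤ^{d+1}` -/

section LatticeCubes

variable {d : ℕ}

open B3Taylor310Lattice (dist₁ dist₁_comm pd rem HolderDeriv norm_rem_le)
open B3Ineq313Lattice (KernelZ cubeIdxZ cubesZ fiberZ cdistZ sum_sum_le_cubesZ exp_dist₁_le_exp_cdistZ)

/-- **The last curly bracket of (3.26) in the printed CUBE-LOCALIZED (3.13) form on `ηℤ^{d+1}`** (twin of p20's torus
`B3Ineq326CurlyCubes.abs_curly2_le_cubes`), PROVED
for every cube side `M ≥ 1` (print: `M = L^{j₁}`, `Mη = L^{j₁}η`): under the hypotheses of `abs_curly2Z_le`,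
`|curly2Z| ≤ (d+1)|τ|(C₁C₂s^{1−(d+1)}s′^{1−(d+1)} + C₃C₄s^{2−(d+1)}s′^{−(d+1)})H(2/δ+8/δ²)(m·m^α)·Σ_{Δ,Δ′}(Mη)^{2(d+1)}(sup_{x∈Λ∩Δ}Σ_μ|A_μ(x)|)
e^{−½δη·dist(Δ,Δ′)/s}e^{−½δη·dist(Δ,Δ′)/s′}` (p26's `sum_sum_le_cubesZ`). [cite: Balaban1983Higgs3, (3.26) p.440] -/
theorem abs_curly2Z_le_cubes (η : ℝ) (hη : 0 < η) {α H τ C₁ C₂ C₃ C₄ δ s s' : ℝ} (hα0 : 0 ≤ α) (hα1 : α ≤ 1) (hH : 0 ≤ H)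
    (hδ : 0 < δ) (hs : 0 < s) (hs' : 0 < s') (Gj Gj' : KernelZ d) (g : (Fin (d + 1) → ℤ) → ℝ) (hg : ∀ x, |g x| ≤ 1)
    (A : Fin (d + 1) → (Fin (d + 1) → ℤ) → ℝ)
    (hA : ∀ (μ' : Fin (d + 1)) (y y' : Fin (d + 1) → ℤ),
      |dAdjKernelZ η⁻¹ μ' Gj y y'| ≤ C₁ * s ^ (1 - ((d + 1 : ℕ) : ℝ)) * Real.exp (-(δ * s⁻¹ * (η * dist₁ y y'))))
    (hA' : ∀ (μ : Fin (d + 1)) (y y' : Fin (d + 1) → ℤ),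
      |dAdjKernelZ η⁻¹ μ Gj' y y'| ≤ C₂ * s' ^ (1 - ((d + 1 : ℕ) : ℝ)) * Real.exp (-(δ * s'⁻¹ * (η * dist₁ y y'))))
    (hB : ∀ y y' : Fin (d + 1) → ℤ, |Gj y y'| ≤ C₃ * s ^ (2 - ((d + 1 : ℕ) : ℝ)) * Real.exp (-(δ * s⁻¹ * (η * dist₁ y y'))))
    (hB' : ∀ (μ' μ : Fin (d + 1)) (y y' : Fin (d + 1) → ℤ),
      |d2KernelZ η⁻¹ μ' μ Gj' y y'| ≤ C₄ * s' ^ (-((d + 1 : ℕ) : ℝ)) * Real.exp (-(δ * s'⁻¹ * (η * dist₁ y y'))))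
    (R : Fin (d + 1) → (Fin (d + 1) → ℤ) → (Fin (d + 1) → ℤ) → ℝ)
    (hR : ∀ (μ' : Fin (d + 1)) (x x' : Fin (d + 1) → ℤ), |R μ' x x'| ≤ H * (η * dist₁ x x') * (η * dist₁ x x') ^ α)
    (Λ Λ' : Finset (Fin (d + 1) → ℤ)) {M : ℕ} (hM : 0 < M) :
    |curly2Z η τ Gj Gj' g A R Λ Λ'| ≤
      ((d + 1 : ℕ) : ℝ) * |τ| * (C₁ * C₂ * (s ^ (1 - ((d + 1 : ℕ) : ℝ)) * s' ^ (1 - ((d + 1 : ℕ) : ℝ))) +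
          C₃ * C₄ * (s ^ (2 - ((d + 1 : ℕ) : ℝ)) * s' ^ (-((d + 1 : ℕ) : ℝ))))
        * H * (2 / δ + 8 / δ ^ 2) * (min s s' * (min s s') ^ α) *
        ∑ c ∈ cubesZ M Λ, ∑ c' ∈ cubesZ M Λ', ((M : ℝ) * η) ^ (2 * (d + 1)) *
          (supOn (fiberZ M Λ c) (fun x => ∑ μ : Fin (d + 1), |A μ x|) *
            (Real.exp (-(δ / 2 * s⁻¹ * (η * (cdistZ M M c c' : ℝ)))) *
              Real.exp (-(δ / 2 * s'⁻¹ * (η * (cdistZ M M c c' : ℝ)))))) := by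
  have hpt := abs_curly2Z_le (τ := τ) η hη hα0 hα1 hH hδ hs hs' Gj Gj' g hg A hA hA' hB hB' R hR Λ Λ'
  have hC₁ : 0 ≤ C₁ := nonneg_of_abs_le_mul_mul (hA 0 0 0) (Real.rpow_pos_of_pos hs _) (Real.exp_pos _)
  have hC₂ : 0 ≤ C₂ := nonneg_of_abs_le_mul_mul (hA' 0 0 0) (Real.rpow_pos_of_pos hs' _) (Real.exp_pos _)
  have hC₃ : 0 ≤ C₃ := nonneg_of_abs_le_mul_mul (hB 0 0) (Real.rpow_pos_of_pos hs _) (Real.exp_pos _)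
  have hC₄ : 0 ≤ C₄ := nonneg_of_abs_le_mul_mul (hB' 0 0 0 0) (Real.rpow_pos_of_pos hs' _) (Real.exp_pos _)
  have hm : 0 < min s s' := lt_min hs hs'
  have hK : 0 ≤ ((d + 1 : ℕ) : ℝ) * |τ| * (C₁ * C₂ * (s ^ (1 - ((d + 1 : ℕ) : ℝ)) * s' ^ (1 - ((d + 1 : ℕ) : ℝ))) +
      C₃ * C₄ * (s ^ (2 - ((d + 1 : ℕ) : ℝ)) * s' ^ (-((d + 1 : ℕ) : ℝ)))) * H * (2 / δ + 8 / δ ^ 2) *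
        (min s s' * (min s s') ^ α) := by
    positivity
  have hloc := sum_sum_le_cubesZ hM hη.le Λ Λ' (fun x => ∑ μ : Fin (d + 1), |A μ x|)
    (fun x => Finset.sum_nonneg fun μ _ => abs_nonneg _)
    (fun x x' => Real.exp (-(δ / 2 * s⁻¹ * (η * dist₁ x x'))) * Real.exp (-(δ / 2 * s'⁻¹ * (η * dist₁ x x'))))
    (fun x x' => by positivity)
    (fun c c' => Real.exp (-(δ / 2 * s⁻¹ * (η * (cdistZ M M c c' : ℝ)))) *
      Real.exp (-(δ / 2 * s'⁻¹ * (η * (cdistZ M M c c' : ℝ)))))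
    (fun x x' => mul_le_mul (exp_dist₁_le_exp_cdistZ (by positivity) hη.le M M x x')
      (exp_dist₁_le_exp_cdistZ (by positivity) hη.le M M x x') (by positivity) (by positivity))
  exact hpt.trans (mul_le_mul_of_nonneg_left hloc hK)

/-- **The last curly bracket of (3.26) in the printed CUBE-LOCALIZED (3.14) form on `ηℤ^{d+1}`** (twin of p20's torus
`B3Ineq326CurlyCubes.abs_curly2_le_local_cubes`),
PROVED for every pair of cube sides `M ≥ 1` (for `Δ(v), Δ(v′)`) and `M″` (for the cube `Δ(v″)` of the second leg `x″` of the propagator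
carrying `A′`): under the hypotheses of `abs_curly2Z_le_local`, the bound of `abs_curly2Z_le_cubes` with `C₅` for `H` and the extra
displayed factor `exp[−½δ₀(L^{j″}η)^{−1}dist(Δ(v),Δ(v″))]` of (3.14). [cite: Balaban1983Higgs3, (3.26) p.440] -/
theorem abs_curly2Z_le_local_cubes (η : ℝ) (hη : 0 < η) {α τ C₁ C₂ C₃ C₄ C₅ δ s s' s'' : ℝ} (hα0 : 0 ≤ α) (hα1 : α ≤ 1)
    (hC₅ : 0 ≤ C₅) (hδ : 0 < δ) (hs : 0 < s) (hs' : 0 < s') (hss : max s s' ≤ s'') (Gj Gj' : KernelZ d)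
    (g : (Fin (d + 1) → ℤ) → ℝ) (hg : ∀ x, |g x| ≤ 1) (A : Fin (d + 1) → (Fin (d + 1) → ℤ) → ℝ)
    (hA : ∀ (μ' : Fin (d + 1)) (y y' : Fin (d + 1) → ℤ),
      |dAdjKernelZ η⁻¹ μ' Gj y y'| ≤ C₁ * s ^ (1 - ((d + 1 : ℕ) : ℝ)) * Real.exp (-(δ * s⁻¹ * (η * dist₁ y y'))))
    (hA' : ∀ (μ : Fin (d + 1)) (y y' : Fin (d + 1) → ℤ),
      |dAdjKernelZ η⁻¹ μ Gj' y y'| ≤ C₂ * s' ^ (1 - ((d + 1 : ℕ) : ℝ)) * Real.exp (-(δ * s'⁻¹ * (η * dist₁ y y'))))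
    (hB : ∀ y y' : Fin (d + 1) → ℤ, |Gj y y'| ≤ C₃ * s ^ (2 - ((d + 1 : ℕ) : ℝ)) * Real.exp (-(δ * s⁻¹ * (η * dist₁ y y'))))
    (hB' : ∀ (μ' μ : Fin (d + 1)) (y y' : Fin (d + 1) → ℤ),
      |d2KernelZ η⁻¹ μ' μ Gj' y y'| ≤ C₄ * s' ^ (-((d + 1 : ℕ) : ℝ)) * Real.exp (-(δ * s'⁻¹ * (η * dist₁ y y'))))
    (R : Fin (d + 1) → (Fin (d + 1) → ℤ) → (Fin (d + 1) → ℤ) → ℝ) (x'' : Fin (d + 1) → ℤ)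
    (hR : ∀ (μ' : Fin (d + 1)) (x x' : Fin (d + 1) → ℤ), |R μ' x x'| ≤
      C₅ * ((η * dist₁ x x') * (η * dist₁ x x') ^ α) * Real.exp (δ / 2 * s''⁻¹ * (η * dist₁ x x')) *
        Real.exp (-(δ / 2 * s''⁻¹ * (η * dist₁ x x''))))
    (Λ Λ' : Finset (Fin (d + 1) → ℤ)) {M M'' : ℕ} (hM : 0 < M) :
    |curly2Z η τ Gj Gj' g A R Λ Λ'| ≤
      ((d + 1 : ℕ) : ℝ) * |τ| * (C₁ * C₂ * (s ^ (1 - ((d + 1 : ℕ) : ℝ)) * s' ^ (1 - ((d + 1 : ℕ) : ℝ))) +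
          C₃ * C₄ * (s ^ (2 - ((d + 1 : ℕ) : ℝ)) * s' ^ (-((d + 1 : ℕ) : ℝ))))
        * C₅ * (2 / δ + 8 / δ ^ 2) * (min s s' * (min s s') ^ α) *
        ∑ c ∈ cubesZ M Λ, ∑ c' ∈ cubesZ M Λ', ((M : ℝ) * η) ^ (2 * (d + 1)) *
          (supOn (fiberZ M Λ c) (fun x => ∑ μ : Fin (d + 1), |A μ x|) *
            (Real.exp (-(δ / 2 * s⁻¹ * (η * (cdistZ M M c c' : ℝ)))) *
              Real.exp (-(δ / 2 * s'⁻¹ * (η * (cdistZ M M c c' : ℝ)))) *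
                Real.exp (-(δ / 2 * s''⁻¹ * (η * (cdistZ M M'' c (cubeIdxZ M'' x'') : ℝ)))))) := by
  have hpt := abs_curly2Z_le_local (τ := τ) η hη hα0 hα1 hC₅ hδ hs hs' hss Gj Gj' g hg A hA hA' hB hB' R x'' hR Λ Λ'
  have hs'' : 0 < s'' := lt_of_lt_of_le (lt_max_of_lt_left hs) hss
  have hC₁ : 0 ≤ C₁ := nonneg_of_abs_le_mul_mul (hA 0 0 0) (Real.rpow_pos_of_pos hs _) (Real.exp_pos _)
  have hC₂ : 0 ≤ C₂ := nonneg_of_abs_le_mul_mul (hA' 0 0 0) (Real.rpow_pos_of_pos hs' _) (Real.exp_pos _)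
  have hC₃ : 0 ≤ C₃ := nonneg_of_abs_le_mul_mul (hB 0 0) (Real.rpow_pos_of_pos hs _) (Real.exp_pos _)
  have hC₄ : 0 ≤ C₄ := nonneg_of_abs_le_mul_mul (hB' 0 0 0 0) (Real.rpow_pos_of_pos hs' _) (Real.exp_pos _)
  have hm : 0 < min s s' := lt_min hs hs'
  have hK : 0 ≤ ((d + 1 : ℕ) : ℝ) * |τ| * (C₁ * C₂ * (s ^ (1 - ((d + 1 : ℕ) : ℝ)) * s' ^ (1 - ((d + 1 : ℕ) : ℝ))) +
      C₃ * C₄ * (s ^ (2 - ((d + 1 : ℕ) : ℝ)) * s' ^ (-((d + 1 : ℕ) : ℝ)))) * C₅ * (2 / δ + 8 / δ ^ 2) *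
        (min s s' * (min s s') ^ α) := by
    positivity
  have hloc := sum_sum_le_cubesZ hM hη.le Λ Λ' (fun x => ∑ μ : Fin (d + 1), |A μ x|)
    (fun x => Finset.sum_nonneg fun μ _ => abs_nonneg _)
    (fun x x' => Real.exp (-(δ / 2 * s⁻¹ * (η * dist₁ x x'))) * Real.exp (-(δ / 2 * s'⁻¹ * (η * dist₁ x x'))) *
      Real.exp (-(δ / 2 * s''⁻¹ * (η * dist₁ x x''))))
    (fun x x' => by positivity)
    (fun c c' => Real.exp (-(δ / 2 * s⁻¹ * (η * (cdistZ M M c c' : ℝ)))) *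
      Real.exp (-(δ / 2 * s'⁻¹ * (η * (cdistZ M M c c' : ℝ)))) *
        Real.exp (-(δ / 2 * s''⁻¹ * (η * (cdistZ M M'' c (cubeIdxZ M'' x'') : ℝ)))))
    (fun x x' => mul_le_mul (mul_le_mul (exp_dist₁_le_exp_cdistZ (by positivity) hη.le M M x x')
      (exp_dist₁_le_exp_cdistZ (by positivity) hη.le M M x x') (by positivity) (by positivity))
      (exp_dist₁_le_exp_cdistZ (by positivity) hη.le M M'' x x'') (by positivity) (by positivity))
  exact hpt.trans (mul_le_mul_of_nonneg_left hloc hK)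

/-- **The last curly bracket of (3.26) FOR THE PRINTED REMAINDER on `ηℤ^{d+1}`** — the bracket LITERALLY: `abs_curly2Z_le` specialized to
`R μ′ = B3Taylor310Lattice.rem η⁻¹ (g′A′_{μ′})` (FILE A's remainder of Taylor's formula (3.10) for the leg `g′A′_{μ′}` along `Γ_{x,x′}`,
i.e. the printed `|x′−x|^{1+α}·Σ_{b⊂Γ_{x,x′}}(η|b_−−x|^α/|x′−x|^{1+α})((∂^ηg′A′_{μ′})(b) − (∂^ηg′A′_{μ′})((b)_x))/|b_−−x|^α`) under the
Hölder hypothesis on the differentiated leg `|(∂^η_ν g′A′_{μ′})(z) − (∂^η_ν g′A′_{μ′})(z′)| ≤ H|z − z′|^α` (*"a differentiation of the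
order 1 + α"*; FILE A's `norm_rem_le`). [cite: Balaban1983Higgs3, (3.26) p.440] -/
theorem abs_curly2Z_rem_le (η : ℝ) (hη : 0 < η) {α H τ C₁ C₂ C₃ C₄ δ s s' : ℝ} (hα0 : 0 ≤ α) (hα1 : α ≤ 1) (hH : 0 ≤ H)
    (hδ : 0 < δ) (hs : 0 < s) (hs' : 0 < s') (Gj Gj' : KernelZ d) (g g' : (Fin (d + 1) → ℤ) → ℝ) (hg : ∀ x, |g x| ≤ 1)
    (A A' : Fin (d + 1) → (Fin (d + 1) → ℤ) → ℝ)
    (hA : ∀ (μ' : Fin (d + 1)) (y y' : Fin (d + 1) → ℤ),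
      |dAdjKernelZ η⁻¹ μ' Gj y y'| ≤ C₁ * s ^ (1 - ((d + 1 : ℕ) : ℝ)) * Real.exp (-(δ * s⁻¹ * (η * dist₁ y y'))))
    (hA' : ∀ (μ : Fin (d + 1)) (y y' : Fin (d + 1) → ℤ),
      |dAdjKernelZ η⁻¹ μ Gj' y y'| ≤ C₂ * s' ^ (1 - ((d + 1 : ℕ) : ℝ)) * Real.exp (-(δ * s'⁻¹ * (η * dist₁ y y'))))
    (hB : ∀ y y' : Fin (d + 1) → ℤ, |Gj y y'| ≤ C₃ * s ^ (2 - ((d + 1 : ℕ) : ℝ)) * Real.exp (-(δ * s⁻¹ * (η * dist₁ y y'))))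
    (hB' : ∀ (μ' μ : Fin (d + 1)) (y y' : Fin (d + 1) → ℤ),
      |d2KernelZ η⁻¹ μ' μ Gj' y y'| ≤ C₄ * s' ^ (-((d + 1 : ℕ) : ℝ)) * Real.exp (-(δ * s'⁻¹ * (η * dist₁ y y'))))
    (hD : ∀ (μ' ν : Fin (d + 1)) (z z' : Fin (d + 1) → ℤ),
      |pd η⁻¹ ν (fun y => g' y * A' μ' y) z - pd η⁻¹ ν (fun y => g' y * A' μ' y) z'| ≤ H * (η * dist₁ z z') ^ α)
    (Λ Λ' : Finset (Fin (d + 1) → ℤ)) :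
    |curly2Z η τ Gj Gj' g A (fun μ' x x' => rem η⁻¹ (fun y => g' y * A' μ' y) x x') Λ Λ'| ≤
      ((d + 1 : ℕ) : ℝ) * |τ| * (C₁ * C₂ * (s ^ (1 - ((d + 1 : ℕ) : ℝ)) * s' ^ (1 - ((d + 1 : ℕ) : ℝ))) +
          C₃ * C₄ * (s ^ (2 - ((d + 1 : ℕ) : ℝ)) * s' ^ (-((d + 1 : ℕ) : ℝ))))
        * H * (2 / δ + 8 / δ ^ 2) * (min s s' * (min s s') ^ α) *
        ∑ x ∈ Λ, ∑ x' ∈ Λ', η ^ (2 * (d + 1)) *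
          ((∑ μ : Fin (d + 1), |A μ x|) *
            (Real.exp (-(δ / 2 * s⁻¹ * (η * dist₁ x x'))) * Real.exp (-(δ / 2 * s'⁻¹ * (η * dist₁ x x'))))) := by
  refine abs_curly2Z_le η hη hα0 hα1 hH hδ hs hs' Gj Gj' g hg A hA hA' hB hB' _ (fun μ' x x' => ?_) Λ Λ'
  have hHol : HolderDeriv η⁻¹ α H (fun y => g' y * A' μ' y) := fun ν z z' => by
    simpa only [inv_inv, Real.norm_eq_abs] using hD μ' ν z z'
  have h := norm_rem_le (inv_pos.mpr hη) hα0 hH hHol x x'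
  rw [inv_inv, Real.norm_eq_abs] at h
  exact h

end LatticeCubes

/-! ## §3 The kernel hypotheses DISCHARGED for the pieces `G^η_{(j)}(0)` of `G_k(0)` on `ηℤ^{d+1}` -/

section ZeroLattice

variable {d : ℕ}

open B4ContourShift (supNorm supNorm_nonneg abs_le_supNorm exists_supNorm_eq)
open B4Thm110ZeroBox (bj sc bj_pos bj_cast sc_pos sc_mul_bj)
open B3Ineq210ZeroLattice (pieceLat pieceLat_comm pieceLat_of_le)
open B3Ineq211ZeroLattice (zeroLatticeKernelsH ineq210_zeroLatticeH scaleH_eq)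
open B3Ineq314ZeroLattice (etaZ scaleZ gpieceZ etaZ_pos scaleZ_pos scale_zeroLatticeKernelsH scaleZ_inv_mul_etaZ_mul
  abs_gpieceZ_le abs_pieceLatMixed_le)
open B3Taylor310Lattice (dist₁ dist₁_comm natAbs_sub_le_dist₁ pd rem HolderDeriv norm_rem_le)
open B3Ineq313Lattice (KernelZ)

/-- kernel: the sup norm is invariant under `v ↦ −v`, so `|x − x′|_∞ = |x′ − x|_∞`. [folklore] -/
private theorem supNorm_sub_comm (x x' : Fin (d + 1) → ℤ) : supNorm (x - x') = supNorm (x' - x) := by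
  unfold supNorm
  congr 1
  funext i
  rw [Pi.sub_apply, Pi.sub_apply, abs_sub_comm]

/-- `|x − x′|₁ ≤ (d+1)|x − x′|_∞`. [folklore] -/
private theorem dist₁_le_mul_supNorm (x x' : Fin (d + 1) → ℤ) :
    (dist₁ x x' : ℝ) ≤ ((d + 1 : ℕ) : ℝ) * supNorm (x - x') := by
  have hterm : ∀ μ : Fin (d + 1), (((x μ - x' μ).natAbs : ℕ) : ℝ) ≤ supNorm (x - x') := by
    intro μ
    have h := abs_le_supNorm (x - x') μ
    rwa [Pi.sub_apply, ← Int.natCast_natAbs, Int.cast_natCast] at h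
  unfold dist₁
  push_cast
  calc ∑ μ : Fin (d + 1), (((x μ - x' μ).natAbs : ℕ) : ℝ) ≤ ∑ _μ : Fin (d + 1), supNorm (x - x') :=
        Finset.sum_le_sum fun μ _ => hterm μ
    _ = ((d : ℝ) + 1) * supNorm (x - x') := by
        rw [Finset.sum_const, Finset.card_univ, Fintype.card_fin, nsmul_eq_mul]; push_cast; ring

/-- kernel: the rate conversion `e^{−δ₁|x−x′|_∞/L^j} ≤ e^{−δ′(L^jη)^{−1}η|x−x′|₁}` for `δ′ ≤ δ₁/(d+1)` (sup norm versus `ℓ¹` norm; the shape of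
FILE C's private `exp_sup_le_exp_dist₁`). [folklore] -/
private theorem exp_sup_le_exp_dist₁ {ℓ k : ℕ} {δ₁ δ' : ℝ} (hδ'0 : 0 ≤ δ') (hδ' : δ' ≤ δ₁ / ((d + 1 : ℕ) : ℝ)) (j : ℕ)
    (x x' : Fin (d + 1) → ℤ) :
    Real.exp (-(δ₁ * supNorm (x - x') / ((bj ℓ j : ℕ) : ℝ))) ≤
      Real.exp (-(δ' * (scaleZ ℓ k j)⁻¹ * (etaZ ℓ k * dist₁ x x'))) := by
  have hbj : (0 : ℝ) < ((bj ℓ j : ℕ) : ℝ) := by exact_mod_cast bj_pos ℓ j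
  have hd1 : (0 : ℝ) < ((d + 1 : ℕ) : ℝ) := by positivity
  have hδ0 : 0 ≤ δ₁ / ((d + 1 : ℕ) : ℝ) := hδ'0.trans hδ'
  have h1 : δ' * (dist₁ x x' : ℝ) ≤ δ₁ * supNorm (x - x') :=
    calc δ' * (dist₁ x x' : ℝ) ≤ (δ₁ / ((d + 1 : ℕ) : ℝ)) * (((d + 1 : ℕ) : ℝ) * supNorm (x - x')) :=
          mul_le_mul hδ' (dist₁_le_mul_supNorm x x') (Nat.cast_nonneg _) hδ0
      _ = δ₁ * supNorm (x - x') := by field_simp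
  rw [Real.exp_le_exp, neg_le_neg_iff, mul_assoc, scaleZ_inv_mul_etaZ_mul, ← mul_div_assoc]
  exact div_le_div_of_nonneg_right h1 hbj.le

/-- `(L^k)^n·(L^{jn})^{−1} = s_j^n` (`j ≤ k`, `s_j = L^{k−j}`). [folklore] -/
private theorem Lk_pow_mul_inv_bj_pow {ℓ k j : ℕ} (hj : j ≤ k) (n : ℕ) :
    ((((ℓ + 1) ^ k : ℕ) : ℝ)) ^ n * ((((bj ℓ j : ℕ) : ℝ)) ^ n)⁻¹ = sc ℓ k j ^ n := by
  have h := sc_mul_bj (ℓ := ℓ) hj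
  rw [bj_cast] at h
  have hL : (0 : ℝ) < ((ℓ : ℝ) + 1) ^ j := by positivity
  push_cast [bj_cast]
  rw [← h, mul_pow]
  field_simp

/-- kernel: `(s⁻¹)^{−n} = s^n` (real exponent). [folklore] -/
private theorem inv_rpow_neg_natCast {s : ℝ} (hs : 0 < s) (n : ℕ) : (s⁻¹) ^ (-(n : ℝ)) = s ^ n := by
  rw [Real.rpow_neg (inv_nonneg.2 hs.le), Real.inv_rpow hs.le, inv_inv, Real.rpow_natCast]

/-- **The (2.10) DERIVATIVE clause in the shape of the (3.26) hypothesis `hA`/`hA'`** — ONE COLUMN DIFFERENCE `(G^η_{(j)}(0)∂^{η*}_μ)(y,x′)`: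
from `Ineq210 δ₁ C` of the carrier `zeroLatticeKernelsH` (p26's `B3Ineq211ZeroLattice.ineq210_zeroLatticeH`, whose derivative member is
the difference in the FIRST variable) and the symmetry `G^η_{(j)}(0)(x,x′) = G^η_{(j)}(0)(x′,x)` (`B3Ineq210ZeroLattice.pieceLat_comm`), for
every rate `0 ≤ δ′ ≤ δ₁/(d+1)`, every `j`, axis `μ` and ALL `y, x′`:
`|(G^η_{(j)}(0)∂^{η*}_μ)(y,x′)| ≤ C(L^jη)^{1−(d+1)}e^{−δ′(L^jη)^{−1}η|y−x′|₁}`. [cite: Balaban1983Higgs3, (2.10) p.426] -/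
theorem abs_dAdjKernelZ_gpieceZ_le {ℓ k : ℕ} {a m2 : ℝ} (hℓ : 1 ≤ ℓ) {δ₁ C : ℝ}
    (h210 : (zeroLatticeKernelsH d ℓ k hℓ a m2).Ineq210 δ₁ C)
    {δ' : ℝ} (hδ'0 : 0 ≤ δ') (hδ' : δ' ≤ δ₁ / ((d + 1 : ℕ) : ℝ)) (j : ℕ) (μ : Fin (d + 1))
    (y x' : Fin (d + 1) → ℤ) :
    |dAdjKernelZ (etaZ ℓ k)⁻¹ μ (gpieceZ ℓ k j a m2) y x'| ≤ C * scaleZ ℓ k j ^ (1 - ((d + 1 : ℕ) : ℝ)) *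
      Real.exp (-(δ' * (scaleZ ℓ k j)⁻¹ * (etaZ ℓ k * dist₁ y x'))) := by
  have hLk : (0 : ℝ) < (((ℓ + 1) ^ k : ℕ) : ℝ) := by positivity
  have hs : 0 < scaleZ ℓ k j := scaleZ_pos ℓ k j
  -- the (2.10) derivative member of the carrier at the pair `(x′, y)`, axis `μ`
  have h := (h210 j x' y).2 μ
  change ((((ℓ + 1) ^ k : ℕ) : ℝ)) ^ (d + 1) *
      (((((ℓ + 1) ^ k : ℕ) : ℝ)) * |pieceLat ℓ k j a m2 (x' + Pi.single μ 1) y - pieceLat ℓ k j a m2 x' y|) ≤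
    C * scaleZ ℓ k j ^ (1 - ((d + 1 : ℕ) : ℝ)) *
      Real.exp (-(δ₁ * (scaleZ ℓ k j)⁻¹ * (supNorm (x' - y) / (((ℓ + 1) ^ k : ℕ) : ℝ)))) at h
  have hC : 0 ≤ C * scaleZ ℓ k j ^ (1 - ((d + 1 : ℕ) : ℝ)) :=
    nonneg_of_mul_nonneg_left (le_trans (by positivity) h) (Real.exp_pos _)
  -- the kernel in terms of the lattice piece, using the symmetry of `G^η_{(j)}(0)`
  have hker : |dAdjKernelZ (etaZ ℓ k)⁻¹ μ (gpieceZ ℓ k j a m2) y x'| =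
      ((((ℓ + 1) ^ k : ℕ) : ℝ)) ^ (d + 1) *
        (((((ℓ + 1) ^ k : ℕ) : ℝ)) * |pieceLat ℓ k j a m2 (x' + Pi.single μ 1) y - pieceLat ℓ k j a m2 x' y|) := by
    simp only [dAdjKernelZ, gpieceZ, etaZ, inv_inv]
    rw [pieceLat_comm y (x' + Pi.single μ 1), pieceLat_comm y x', ← mul_sub, ← mul_assoc, abs_mul, abs_mul,
      abs_of_nonneg hLk.le, abs_of_nonneg (by positivity : (0:ℝ) ≤ ((((ℓ + 1) ^ k : ℕ) : ℝ)) ^ (d + 1))]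
    ring
  rw [hker]
  refine h.trans (mul_le_mul_of_nonneg_left ?_ hC)
  have hx : supNorm (x' - y) = supNorm (y - x') := supNorm_sub_comm x' y
  rw [hx, Real.exp_le_exp, neg_le_neg_iff]
  have hd1 : (0 : ℝ) < ((d + 1 : ℕ) : ℝ) := by positivity
  have hδ0 : 0 ≤ δ₁ / ((d + 1 : ℕ) : ℝ) := hδ'0.trans hδ'
  have h1 : δ' * (dist₁ y x' : ℝ) ≤ δ₁ * supNorm (y - x') :=
    calc δ' * (dist₁ y x' : ℝ) ≤ (δ₁ / ((d + 1 : ℕ) : ℝ)) * (((d + 1 : ℕ) : ℝ) * supNorm (y - x')) :=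
          mul_le_mul hδ' (dist₁_le_mul_supNorm y x') (Nat.cast_nonneg _) hδ0
      _ = δ₁ * supNorm (y - x') := by field_simp
  have hc : 0 ≤ (scaleZ ℓ k j)⁻¹ * etaZ ℓ k := mul_nonneg (inv_nonneg.2 hs.le) (etaZ_pos ℓ k).le
  calc δ' * (scaleZ ℓ k j)⁻¹ * (etaZ ℓ k * (dist₁ y x' : ℝ))
      = ((scaleZ ℓ k j)⁻¹ * etaZ ℓ k) * (δ' * (dist₁ y x' : ℝ)) := by ring
    _ ≤ ((scaleZ ℓ k j)⁻¹ * etaZ ℓ k) * (δ₁ * supNorm (y - x')) := mul_le_mul_of_nonneg_left h1 hc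
    _ = δ₁ * (scaleZ ℓ k j)⁻¹ * (supNorm (y - x') / (((ℓ + 1) ^ k : ℕ) : ℝ)) := by unfold etaZ; ring

/-- **The (2.10) TWICE-DIFFERENTIATED clause in the shape of the (3.26) hypothesis `hB'`** — ARBITRARY AXES `μ′, μ`
(`(∂^η_{μ′}G^η_{(j)}(0)∂^{η*}_μ)(x,x′)`; the off-diagonal twin of FILE C's `abs_dKernelZ_gpieceZ_le`): from FILE C's located mixed member
`abs_pieceLatMixed_le` (rate `δ₁`, constant `C`, every pair of axes), for every rate `0 ≤ δ′ ≤ δ₁/(d+1)`, every `j`, axes `μ′, μ` and ALL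
`x, x′`: `|(∂^η_{μ′}G^η_{(j)}(0)∂^{η*}_μ)(x,x′)| ≤ C(L^jη)^{−(d+1)}e^{−δ′(L^jη)^{−1}η|x−x′|₁}` (for `j ≥ k` there is no piece and the kernel
vanishes). [cite: Balaban1983Higgs3, (2.10) p.426] -/
theorem abs_d2KernelZ_gpieceZ_le {ℓ k : ℕ} {a m2 : ℝ} (hℓ : 1 ≤ ℓ) (hk : 1 ≤ k) {δ₁ C : ℝ} (hC : 0 ≤ C)
    (hM : ∀ (j : ℕ), j < k → ∀ (μ ν : Fin (d + 1)) (x x' : Fin (d + 1) → ℤ),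
      ((((ℓ + 1) ^ k : ℕ)) : ℝ) ^ 2 *
          |(pieceLat ℓ k j a m2 (x + Pi.single μ 1) (x' + Pi.single ν 1) - pieceLat ℓ k j a m2 x (x' + Pi.single ν 1))
            - (pieceLat ℓ k j a m2 (x + Pi.single μ 1) x' - pieceLat ℓ k j a m2 x x')|
        ≤ C * ((((bj ℓ j : ℕ) : ℝ) ^ (d + 1))⁻¹) * Real.exp (-(δ₁ * supNorm (x - x') / ((bj ℓ j : ℕ) : ℝ))))
    {δ' : ℝ} (hδ'0 : 0 ≤ δ') (hδ' : δ' ≤ δ₁ / ((d + 1 : ℕ) : ℝ)) (j : ℕ) (μ' μ : Fin (d + 1))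
    (x x' : Fin (d + 1) → ℤ) :
    |d2KernelZ (etaZ ℓ k)⁻¹ μ' μ (gpieceZ ℓ k j a m2) x x'| ≤ C * scaleZ ℓ k j ^ (-((d + 1 : ℕ) : ℝ)) *
      Real.exp (-(δ' * (scaleZ ℓ k j)⁻¹ * (etaZ ℓ k * dist₁ x x'))) := by
  have hLk : (0 : ℝ) < (((ℓ + 1) ^ k : ℕ) : ℝ) := by positivity
  have hs : 0 < scaleZ ℓ k j := scaleZ_pos ℓ k j
  have hker : d2KernelZ (etaZ ℓ k)⁻¹ μ' μ (gpieceZ ℓ k j a m2) x x' =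
      ((((ℓ + 1) ^ k : ℕ) : ℝ)) ^ (d + 1) * (((((ℓ + 1) ^ k : ℕ)) : ℝ) ^ 2 *
        ((pieceLat ℓ k j a m2 (x + Pi.single μ' 1) (x' + Pi.single μ 1) - pieceLat ℓ k j a m2 x (x' + Pi.single μ 1))
          - (pieceLat ℓ k j a m2 (x + Pi.single μ' 1) x' - pieceLat ℓ k j a m2 x x'))) := by
    simp only [d2KernelZ, gpieceZ, etaZ, inv_inv]; ring
  have hRHS : 0 ≤ C * scaleZ ℓ k j ^ (-((d + 1 : ℕ) : ℝ)) *
      Real.exp (-(δ' * (scaleZ ℓ k j)⁻¹ * (etaZ ℓ k * dist₁ x x'))) :=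
    mul_nonneg (mul_nonneg hC (Real.rpow_pos_of_pos hs _).le) (Real.exp_pos _).le
  rcases Nat.lt_or_ge j k with hjk | hkj
  · have hb := hM j hjk μ' μ x x'
    have hpow : scaleZ ℓ k j ^ (-((d + 1 : ℕ) : ℝ)) = sc ℓ k j ^ (d + 1) := by
      rw [← scale_zeroLatticeKernelsH (d := d) hℓ a m2 j, scaleH_eq hjk.le, inv_rpow_neg_natCast (sc_pos ℓ k j)]
    rw [hker, abs_mul, abs_of_nonneg (by positivity : (0:ℝ) ≤ ((((ℓ + 1) ^ k : ℕ) : ℝ)) ^ (d + 1)), abs_mul,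
      abs_of_nonneg (by positivity : (0:ℝ) ≤ ((((ℓ + 1) ^ k : ℕ) : ℝ)) ^ 2)]
    calc ((((ℓ + 1) ^ k : ℕ) : ℝ)) ^ (d + 1) * (((((ℓ + 1) ^ k : ℕ)) : ℝ) ^ 2 *
          |(pieceLat ℓ k j a m2 (x + Pi.single μ' 1) (x' + Pi.single μ 1) - pieceLat ℓ k j a m2 x (x' + Pi.single μ 1))
            - (pieceLat ℓ k j a m2 (x + Pi.single μ' 1) x' - pieceLat ℓ k j a m2 x x')|)
        ≤ ((((ℓ + 1) ^ k : ℕ) : ℝ)) ^ (d + 1) * (C * ((((bj ℓ j : ℕ) : ℝ) ^ (d + 1))⁻¹)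
            * Real.exp (-(δ₁ * supNorm (x - x') / ((bj ℓ j : ℕ) : ℝ)))) :=
          mul_le_mul_of_nonneg_left hb (by positivity)
      _ = C * (((((ℓ + 1) ^ k : ℕ) : ℝ)) ^ (d + 1) * ((((bj ℓ j : ℕ) : ℝ)) ^ (d + 1))⁻¹)
            * Real.exp (-(δ₁ * supNorm (x - x') / ((bj ℓ j : ℕ) : ℝ))) := by ring
      _ = C * scaleZ ℓ k j ^ (-((d + 1 : ℕ) : ℝ)) * Real.exp (-(δ₁ * supNorm (x - x') / ((bj ℓ j : ℕ) : ℝ))) := by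
          rw [Lk_pow_mul_inv_bj_pow hjk.le, hpow]
      _ ≤ C * scaleZ ℓ k j ^ (-((d + 1 : ℕ) : ℝ)) * Real.exp (-(δ' * (scaleZ ℓ k j)⁻¹ * (etaZ ℓ k * dist₁ x x'))) :=
          mul_le_mul_of_nonneg_left (exp_sup_le_exp_dist₁ hδ'0 hδ' j x x')
            (mul_nonneg hC (Real.rpow_pos_of_pos hs _).le)
  · have hj1 : 1 ≤ j := le_trans hk hkj
    have hp : ∀ y y' : Fin (d + 1) → ℤ, pieceLat ℓ k j a m2 y y' = 0 := fun y y' => pieceLat_of_le hj1 hkj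
    rw [hker]
    simp only [hp, sub_self, mul_zero, abs_zero]
    exact hRHS

/-- kernel: a rate below three given rates, `δ′ = min(δa, δb, δc)/(d+1)`. [folklore] -/
private theorem rate_aux3 {δa δb δc : ℝ} (ha : 0 < δa) (hb : 0 < δb) (hc : 0 < δc) (d : ℕ) :
    0 < min δa (min δb δc) / ((d + 1 : ℕ) : ℝ) ∧
      min δa (min δb δc) / ((d + 1 : ℕ) : ℝ) ≤ δa / ((d + 1 : ℕ) : ℝ) ∧
      min δa (min δb δc) / ((d + 1 : ℕ) : ℝ) ≤ δb / ((d + 1 : ℕ) : ℝ) ∧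
      min δa (min δb δc) / ((d + 1 : ℕ) : ℝ) ≤ δc / ((d + 1 : ℕ) : ℝ) := by
  have hd : (0 : ℝ) < ((d + 1 : ℕ) : ℝ) := by positivity
  refine ⟨div_pos (lt_min ha (lt_min hb hc)) hd, div_le_div_of_nonneg_right (min_le_left _ _) hd.le,
    div_le_div_of_nonneg_right ((min_le_right _ _).trans (min_le_left _ _)) hd.le,
    div_le_div_of_nonneg_right ((min_le_right _ _).trans (min_le_right _ _)) hd.le⟩

/-- **The last curly bracket of (3.26) FOR THE PIECES OF `G_k(0)` ON `ηℤ^{d+1}`, ALL FOUR KERNEL HYPOTHESES DISCHARGED** (the `ℤ^{d+1}`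
instance of `abs_curly2Z_le`; the (3.26) companion of FILE C's `abs_term312Z_le_zeroLattice`): for `L = ℓ + 1 ≥ 2` and a window
`[a₋,a₊] × [0,m²₊]` (`a₋ > 0`) there are `δ′, C′ > 0` such that for EVERY scale `k ≥ 1` (`η = L^{−k}`), every window point, all line indices
`j, j′`, every `τ` (= tr q²), localization `|g| ≤ 1`, vector leg `A`, remainder `R` with `|R_{μ′}(x,x′)| ≤ H·u·u^α` (`0 ≤ α ≤ 1`) and finite
localization sets `Λ, Λ′`, the last curly bracket of (3.26) with the lines `G^η_{(j)}(0)`, `G^η_{(j′)}(0)` (`gpieceZ`) satisfies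
`|curly2Z| ≤ C′|τ|H·[(L^jη)^{1−(d+1)}(L^{j′}η)^{1−(d+1)} + (L^jη)^{2−(d+1)}(L^{j′}η)^{−(d+1)}]·(m·m^α)·Σ_{x∈Λ,x′∈Λ′}η^{2(d+1)}(Σ_μ|A_μ(x)|)
e^{−½δ′η|x−x′|₁/L^jη}e^{−½δ′η|x−x′|₁/L^{j′}η}`, `m = min(L^jη, L^{j′}η) = L^{j₁}η` — NO kernel hypothesis (value: FILE C `abs_gpieceZ_le`;
one column difference: `abs_dAdjKernelZ_gpieceZ_le`; mixed, arbitrary axes: `abs_d2KernelZ_gpieceZ_le`; sources p26's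
`ineq210_zeroLatticeH` and FILE C's `abs_pieceLatMixed_le`). [cite: Balaban1983Higgs3, (3.26) p.440] -/
theorem abs_curly2Z_le_zeroLattice (d ℓ : ℕ) (hℓ : 1 ≤ ℓ) (amin aplus m2plus : ℝ) (ha : 0 < amin) :
    ∃ δ' C' : ℝ, 0 < δ' ∧ 0 < C' ∧ ∀ (k : ℕ), 1 ≤ k → ∀ (a m2 : ℝ), amin ≤ a → a ≤ aplus → 0 ≤ m2 → m2 ≤ m2plus →
      ∀ (j j' : ℕ) {α H : ℝ} (τ : ℝ), 0 ≤ α → α ≤ 1 → 0 ≤ H →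
        ∀ (g : (Fin (d + 1) → ℤ) → ℝ), (∀ x, |g x| ≤ 1) → ∀ (A : Fin (d + 1) → (Fin (d + 1) → ℤ) → ℝ)
        (R : Fin (d + 1) → (Fin (d + 1) → ℤ) → (Fin (d + 1) → ℤ) → ℝ),
          (∀ (μ' : Fin (d + 1)) (x x' : Fin (d + 1) → ℤ),
            |R μ' x x'| ≤ H * (etaZ ℓ k * dist₁ x x') * (etaZ ℓ k * dist₁ x x') ^ α) →
        ∀ (Λ Λ' : Finset (Fin (d + 1) → ℤ)),
          |curly2Z (etaZ ℓ k) τ (gpieceZ ℓ k j a m2) (gpieceZ ℓ k j' a m2) g A R Λ Λ'| ≤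
            C' * |τ| * H *
              (scaleZ ℓ k j ^ (1 - ((d + 1 : ℕ) : ℝ)) * scaleZ ℓ k j' ^ (1 - ((d + 1 : ℕ) : ℝ)) +
                scaleZ ℓ k j ^ (2 - ((d + 1 : ℕ) : ℝ)) * scaleZ ℓ k j' ^ (-((d + 1 : ℕ) : ℝ))) *
              (min (scaleZ ℓ k j) (scaleZ ℓ k j') * (min (scaleZ ℓ k j) (scaleZ ℓ k j')) ^ α) *
              ∑ x ∈ Λ, ∑ x' ∈ Λ', etaZ ℓ k ^ (2 * (d + 1)) *
                ((∑ μ : Fin (d + 1), |A μ x|) *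
                  (Real.exp (-(δ' / 2 * (scaleZ ℓ k j)⁻¹ * (etaZ ℓ k * dist₁ x x'))) *
                    Real.exp (-(δ' / 2 * (scaleZ ℓ k j')⁻¹ * (etaZ ℓ k * dist₁ x x'))))) := by
  obtain ⟨δa, Ca, hδa, hCa, hA⟩ := ineq210_zeroLatticeH d ℓ hℓ amin aplus m2plus ha
  obtain ⟨δm, Cm, hδm, hCm, hM⟩ := abs_pieceLatMixed_le d ℓ hℓ amin aplus m2plus ha
  obtain ⟨hδ'0, hδ'a, hδ'm, -⟩ := rate_aux3 hδa hδm hδm d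
  set δ' : ℝ := min δa (min δm δm) / ((d + 1 : ℕ) : ℝ) with hδ'def
  refine ⟨δ', ((d + 1 : ℕ) : ℝ) * (max Ca Cm) ^ 2 * (2 / δ' + 8 / δ' ^ 2), hδ'0, by positivity, ?_⟩
  intro k hk a m2 h1 h2 h3 h4 j j' α H τ hα0 hα1 hH g hg A R hR Λ Λ'
  have h210 := hA k hk a m2 h1 h2 h3 h4
  have hMk := hM k hk
  have hCa' : Ca ≤ max Ca Cm := le_max_left _ _
  have hCm' : Cm ≤ max Ca Cm := le_max_right _ _
  have hmax : 0 ≤ max Ca Cm := hCa.le.trans hCa'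
  -- the four kernel hypotheses for the pieces, at the common rate `δ′`
  have hA1 : ∀ (μ' : Fin (d + 1)) (y y' : Fin (d + 1) → ℤ),
      |dAdjKernelZ (etaZ ℓ k)⁻¹ μ' (gpieceZ ℓ k j a m2) y y'| ≤ Ca * scaleZ ℓ k j ^ (1 - ((d + 1 : ℕ) : ℝ)) *
        Real.exp (-(δ' * (scaleZ ℓ k j)⁻¹ * (etaZ ℓ k * dist₁ y y'))) := fun μ' y y' =>
    abs_dAdjKernelZ_gpieceZ_le hℓ h210 hδ'0.le hδ'a j μ' y y'
  have hA2 : ∀ (μ : Fin (d + 1)) (y y' : Fin (d + 1) → ℤ),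
      |dAdjKernelZ (etaZ ℓ k)⁻¹ μ (gpieceZ ℓ k j' a m2) y y'| ≤ Ca * scaleZ ℓ k j' ^ (1 - ((d + 1 : ℕ) : ℝ)) *
        Real.exp (-(δ' * (scaleZ ℓ k j')⁻¹ * (etaZ ℓ k * dist₁ y y'))) := fun μ y y' =>
    abs_dAdjKernelZ_gpieceZ_le hℓ h210 hδ'0.le hδ'a j' μ y y'
  have hB1 : ∀ y y' : Fin (d + 1) → ℤ, |gpieceZ ℓ k j a m2 y y'| ≤ Ca * scaleZ ℓ k j ^ (2 - ((d + 1 : ℕ) : ℝ)) *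
      Real.exp (-(δ' * (scaleZ ℓ k j)⁻¹ * (etaZ ℓ k * dist₁ y y'))) := fun y y' =>
    abs_gpieceZ_le hℓ h210 hδ'0.le hδ'a j y y'
  have hB2 : ∀ (μ' μ : Fin (d + 1)) (y y' : Fin (d + 1) → ℤ),
      |d2KernelZ (etaZ ℓ k)⁻¹ μ' μ (gpieceZ ℓ k j' a m2) y y'| ≤ Cm * scaleZ ℓ k j' ^ (-((d + 1 : ℕ) : ℝ)) *
        Real.exp (-(δ' * (scaleZ ℓ k j')⁻¹ * (etaZ ℓ k * dist₁ y y'))) := fun μ' μ y y' =>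
    abs_d2KernelZ_gpieceZ_le hℓ hk hCm.le (fun j hj μ ν x x' => hMk j hj a m2 h1 h2 h3 h4 μ ν x x') hδ'0.le hδ'm j' μ' μ y y'
  have h := abs_curly2Z_le (τ := τ) (etaZ ℓ k) (etaZ_pos ℓ k) hα0 hα1 hH hδ'0 (scaleZ_pos ℓ k j) (scaleZ_pos ℓ k j')
    (gpieceZ ℓ k j a m2) (gpieceZ ℓ k j' a m2) g hg A hA1 hA2 hB1 hB2 R hR Λ Λ'
  refine h.trans ?_
  -- absorb the constants: `Ca·Ca ≤ (max Ca Cm)²`, `Ca·Cm ≤ (max Ca Cm)²`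
  have hs1 : 0 < scaleZ ℓ k j := scaleZ_pos ℓ k j
  have hs2 : 0 < scaleZ ℓ k j' := scaleZ_pos ℓ k j'
  set P1 : ℝ := scaleZ ℓ k j ^ (1 - ((d + 1 : ℕ) : ℝ)) * scaleZ ℓ k j' ^ (1 - ((d + 1 : ℕ) : ℝ)) with hP1
  set P2 : ℝ := scaleZ ℓ k j ^ (2 - ((d + 1 : ℕ) : ℝ)) * scaleZ ℓ k j' ^ (-((d + 1 : ℕ) : ℝ)) with hP2
  have hP1' : 0 ≤ P1 := by positivity
  have hP2' : 0 ≤ P2 := by positivity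
  set S : ℝ := ∑ x ∈ Λ, ∑ x' ∈ Λ', etaZ ℓ k ^ (2 * (d + 1)) *
    ((∑ μ : Fin (d + 1), |A μ x|) *
      (Real.exp (-(δ' / 2 * (scaleZ ℓ k j)⁻¹ * (etaZ ℓ k * dist₁ x x'))) *
        Real.exp (-(δ' / 2 * (scaleZ ℓ k j')⁻¹ * (etaZ ℓ k * dist₁ x x'))))) with hS
  have hS0 : 0 ≤ S := Finset.sum_nonneg fun x _ => Finset.sum_nonneg fun x' _ =>
    mul_nonneg (pow_nonneg (etaZ_pos ℓ k).le _)
      (mul_nonneg (Finset.sum_nonneg fun μ _ => abs_nonneg _) (by positivity))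
  have hW : 0 ≤ (2 / δ' + 8 / δ' ^ 2) := by positivity
  have hmm : 0 ≤ min (scaleZ ℓ k j) (scaleZ ℓ k j') * (min (scaleZ ℓ k j) (scaleZ ℓ k j')) ^ α := by
    have : 0 < min (scaleZ ℓ k j) (scaleZ ℓ k j') := lt_min hs1 hs2
    positivity
  have hcoef : Ca * Ca * P1 + Ca * Cm * P2 ≤ (max Ca Cm) ^ 2 * (P1 + P2) := by
    have e1 : Ca * Ca ≤ (max Ca Cm) ^ 2 := by
      rw [sq]; exact mul_le_mul hCa' hCa' hCa.le hmax
    have e2 : Ca * Cm ≤ (max Ca Cm) ^ 2 := by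
      rw [sq]; exact mul_le_mul hCa' hCm' hCm.le hmax
    nlinarith [mul_le_mul_of_nonneg_right e1 hP1', mul_le_mul_of_nonneg_right e2 hP2']
  have hτH : 0 ≤ |τ| * H := mul_nonneg (abs_nonneg _) hH
  calc ((d + 1 : ℕ) : ℝ) * |τ| * (Ca * Ca * P1 + Ca * Cm * P2) * H * (2 / δ' + 8 / δ' ^ 2) *
        (min (scaleZ ℓ k j) (scaleZ ℓ k j') * (min (scaleZ ℓ k j) (scaleZ ℓ k j')) ^ α) * S
      = (Ca * Ca * P1 + Ca * Cm * P2) * (((d + 1 : ℕ) : ℝ) * (|τ| * H) * (2 / δ' + 8 / δ' ^ 2) *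
        (min (scaleZ ℓ k j) (scaleZ ℓ k j') * (min (scaleZ ℓ k j) (scaleZ ℓ k j')) ^ α) * S) := by ring
    _ ≤ ((max Ca Cm) ^ 2 * (P1 + P2)) * (((d + 1 : ℕ) : ℝ) * (|τ| * H) * (2 / δ' + 8 / δ' ^ 2) *
        (min (scaleZ ℓ k j) (scaleZ ℓ k j') * (min (scaleZ ℓ k j) (scaleZ ℓ k j')) ^ α) * S) :=
        mul_le_mul_of_nonneg_right hcoef (by positivity)
    _ = ((d + 1 : ℕ) : ℝ) * (max Ca Cm) ^ 2 * (2 / δ' + 8 / δ' ^ 2) * |τ| * H * (P1 + P2) *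
        (min (scaleZ ℓ k j) (scaleZ ℓ k j') * (min (scaleZ ℓ k j) (scaleZ ℓ k j')) ^ α) * S := by ring

/-- **The last curly bracket of (3.26) AS IT ENTERS p39's `eq326Z`, FOR THE PIECES OF `G_k(0)`, KERNEL HYPOTHESES DISCHARGED**: the
corollary of `abs_curly2Z_le_zeroLattice` for the remainder leg `R μ′ = rem η⁻¹ (g′A′_{μ′})` (Taylor (3.10), FILE A) under the Hölder
hypothesis on the differentiated leg `|(∂^η_ν g′A′_{μ′})(z) − (∂^η_ν g′A′_{μ′})(z′)| ≤ H|z − z′|^α` (*"a differentiation of the order 1 + α"*;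
the only hypothesis left, as in FILE C's `abs_term312Z_le_zeroLattice`): for `L = ℓ + 1 ≥ 2` and a window there are `δ′, C′ > 0` with
`|curly2Z η τ (G^η_{(j)}(0)) (G^η_{(j′)}(0)) g A (rem η⁻¹ (g′A′)) Λ Λ′| ≤ C′|τ|H·[(L^jη)^{1−(d+1)}(L^{j′}η)^{1−(d+1)} + (L^jη)^{2−(d+1)}(L^{j′}η)^{−(d+1)}]
·(m·m^α)·Σ_{x∈Λ,x′∈Λ′}η^{2(d+1)}(Σ_μ|A_μ(x)|)e^{−½δ′η|x−x′|₁/L^jη}e^{−½δ′η|x−x′|₁/L^{j′}η}` for every `k ≥ 1`, window point, `j, j′`, `τ`, `|g| ≤ 1`,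
`A`, `A′`, `Λ, Λ′`. [cite: Balaban1983Higgs3, (3.26) p.440] -/
theorem abs_curly2Z_rem_le_zeroLattice (d ℓ : ℕ) (hℓ : 1 ≤ ℓ) (amin aplus m2plus : ℝ) (ha : 0 < amin) :
    ∃ δ' C' : ℝ, 0 < δ' ∧ 0 < C' ∧ ∀ (k : ℕ), 1 ≤ k → ∀ (a m2 : ℝ), amin ≤ a → a ≤ aplus → 0 ≤ m2 → m2 ≤ m2plus →
      ∀ (j j' : ℕ) {α H : ℝ} (τ : ℝ), 0 ≤ α → α ≤ 1 → 0 ≤ H →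
        ∀ (g g' : (Fin (d + 1) → ℤ) → ℝ), (∀ x, |g x| ≤ 1) → ∀ (A A' : Fin (d + 1) → (Fin (d + 1) → ℤ) → ℝ),
          (∀ (μ' ν : Fin (d + 1)) (z z' : Fin (d + 1) → ℤ),
            |pd (etaZ ℓ k)⁻¹ ν (fun y => g' y * A' μ' y) z - pd (etaZ ℓ k)⁻¹ ν (fun y => g' y * A' μ' y) z'| ≤
              H * (etaZ ℓ k * dist₁ z z') ^ α) →
        ∀ (Λ Λ' : Finset (Fin (d + 1) → ℤ)),
          |curly2Z (etaZ ℓ k) τ (gpieceZ ℓ k j a m2) (gpieceZ ℓ k j' a m2) g A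
              (fun μ' x x' => rem (etaZ ℓ k)⁻¹ (fun y => g' y * A' μ' y) x x') Λ Λ'| ≤
            C' * |τ| * H *
              (scaleZ ℓ k j ^ (1 - ((d + 1 : ℕ) : ℝ)) * scaleZ ℓ k j' ^ (1 - ((d + 1 : ℕ) : ℝ)) +
                scaleZ ℓ k j ^ (2 - ((d + 1 : ℕ) : ℝ)) * scaleZ ℓ k j' ^ (-((d + 1 : ℕ) : ℝ))) *
              (min (scaleZ ℓ k j) (scaleZ ℓ k j') * (min (scaleZ ℓ k j) (scaleZ ℓ k j')) ^ α) *
              ∑ x ∈ Λ, ∑ x' ∈ Λ', etaZ ℓ k ^ (2 * (d + 1)) *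
                ((∑ μ : Fin (d + 1), |A μ x|) *
                  (Real.exp (-(δ' / 2 * (scaleZ ℓ k j)⁻¹ * (etaZ ℓ k * dist₁ x x'))) *
                    Real.exp (-(δ' / 2 * (scaleZ ℓ k j')⁻¹ * (etaZ ℓ k * dist₁ x x'))))) := by
  obtain ⟨δ', C', hδ', hC', h⟩ := abs_curly2Z_le_zeroLattice d ℓ hℓ amin aplus m2plus ha
  refine ⟨δ', C', hδ', hC', ?_⟩
  intro k hk a m2 h1 h2 h3 h4 j j' α H τ hα0 hα1 hH g g' hg A A' hD Λ Λ'
  refine h k hk a m2 h1 h2 h3 h4 j j' τ hα0 hα1 hH g hg A _ (fun μ' x x' => ?_) Λ Λ'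
  have hη : 0 < etaZ ℓ k := etaZ_pos ℓ k
  have hHol : HolderDeriv (etaZ ℓ k)⁻¹ α H (fun y => g' y * A' μ' y) := fun ν z z' => by
    simpa only [inv_inv, Real.norm_eq_abs] using hD μ' ν z z'
  have hr := norm_rem_le (inv_pos.mpr hη) hα0 hH hHol x x'
  rw [inv_inv, Real.norm_eq_abs] at hr
  exact hr

end ZeroLattice

end

end Literature.MathematicalPhysics.QuantumFieldTheory.Balaban1983to89.B3Ineq326LastBracketLattice
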